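import Literature.AlgebraicGeometry.ComplexMultiplication.CyclotomicFermatCMTypesTwoPowerLevelFamilies
import HarnessLib

/-!
# Koblitz–Rohrlich THEOREM 4 (`N = 2ⁿ`) — COMPLETENESS: the §5 PROPOSITION ("the only isogenies apart from the obvious ones")
# for EVERY `n ≥ 4`, read off the parity criterion at `p = 2`

Layer `Literature/AlgebraicGeometry/ComplexMultiplication`, namespace `…ComplexMultiplication.CyclotomicFermatCMType`; sequel of
`CyclotomicFermatCMTypesTwoPowerLevelFamilies` (tools at `p = 2`; existence of the families for every `n`) and of
`CyclotomicFermatCMTypesPrimePowerParityCriterion` (at `N = pⁿ`, ANY prime `p`: `H_{τ′} = H_τ` iff for every unit `x`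
`μ_τ(x) + μ_{τ′}(−x) = μ_τ(−x) + μ_{τ′}(x)`, `μ_τ(x) = #{a ∈ τ : p^{v(a)}x = a}` — tree `countP_add_countP_eq_of_fermatCMType_eq`).
THEOREMS ONLY (no definition, no named fact, no `sorry`, no kernel `decide` on residues).  Before this file the tree had Theorem 4's
completeness ("the only isogenies") by kernel enumeration at `N = 8` and, normalised, `N = 16` (`…TwoPowerLevelIsogenies`,
`…TwoPowerLevelSixteen`), and the existence half for every `n` (`…TwoPowerLevelCoincidences`, `…TwoPowerLevelFurthermore`,
`…TwoPowerLevelUniformLevel`, `…TwoPowerLevelFamilies`); the siblings' honest columns: "Theorem 4's completeness … is NOT typed for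
general `n`".

THE SOURCE.  N. Koblitz, D. Rohrlich, *Simple factors in the Jacobian of a Fermat curve*, Canad. J. Math. **30** (1978) 1183–1205
(held `paper:koblitz1978-simple-factors-jacobian-fermat-curve`).  THEOREM 4 (p. 1186): "Suppose `N = 2ⁿ`. Then the only isogenies
apart from the obvious ones are between pairs of lattices corresponding to the triples a) … e) …".  §5 (p. 1200): "Theorem 4 can be
restated as follows.  PROPOSITION. Let `N = 2ⁿ`, `n ≥ 4`. Let `N₁ = 2ⁿ⁻¹`, `N₂ = 2ⁿ⁻²`, `τ = (r, s, t)`, `τ′ = (r′, s′, t′)`, `H_τ = H_{τ′}`.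
Suppose that `τ′` is not a permutation of `τ`, and that g.c.d.`(r, s, t, r′, s′, t′) = 1`.  Then for some `u ∈ (ℤ/Nℤ)*`, `uτ` and
`uτ′` are permutations of one of the following pairs of triples: (1) `(N − 4, 1, 3)`, `(N₁ − 2, N₁ − 1, 3)`; (2) any 2 of the triples
`(N − 2, 1, 1)`, `(N₁, 1, N₁ − 1)`, `(2, N₁ − 1, N₁ − 1)`; (3) any 2 of the triples `(N − 4, 2, 2)`, `(N₁, 2, N₁ − 2)`, `(N₁ − 2, 1, N₁ + 1)`,
`(2, N₂ − 1, 3N₂ − 1)`.  Proof. Most of the proof is similar to the proof of Theorem 2, and will be omitted.  However, one case is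
somewhat harder.  When `N = 2ⁿ`, there is no 'relatively prime case' … (since at least one component in a triple must be even).
Instead, the 'relatively prime case' … occurs when, say, `2 | r, r′`; `4 ∤ r, r′`; `2 ∤ s t s′t′` … our proof … needs another technique,
based on a probabilistic consideration" (the PROBABILISTIC LEMMA, pp. 1201–1205, `n ≥ 9`; "verified by computer for `N = 16, 32, 64,
128, 256`").

## What is proved (`N = 2ⁿ`, `n ≥ 4`; `N₁ = 2ⁿ⁻¹`, `N₂ = 2ⁿ⁻²` written `(2 : ZMod (2 ^ n)) ^ (n - 1)`, `… ^ (n - 2)`; triples `τ = (r, s, t)`,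
## `τ′ = (r′, s′, t′)` of NON-ZERO residues with `r + s + t = 0 = r′ + s′ + t′`)

* §1 Arithmetic modulo `2ⁿ` (`2N₁ = 0`, `2N₂ = N₁`, `2ᵏN₁ = 0`, `N₁y ∈ {0, N₁}`, `N₂x ∈ {N₂, 3N₂}` for odd `x`, valuations `v(2ᵏu) = k` and
  their separation, `v(−a) = v(a)`), reduction modulo `2` (units = odd residues; **`pattern_of_triple_two`**: a triple with sum `0` has
  no odd entry or exactly two) and modulo `4` (**`two_mul_ne_of_castHom_four`**: `2s ≢ 0 (mod 4)` for odd `s` — the one inequality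
  behind every exclusion below); triples as multisets.
* §2 The fibre predicate `2^{v(a)}y = a` at `p = 2`: a unit entry is counted at `y` iff `y = a`; an entry `2c` iff `y ∈ {c, c + N₁}`;
  the entry `N₁` at every unit; **periodicity** `fibre_add_iff` (an even entry's fibre is `N₁`-periodic, an entry of valuation `≥ 2`
  is `N₂`-periodic); `eq_pow_pred_of_fibre_of_fibre_neg` (an entry counted at `y` and `−y` is `N₁`).
* §3 Two odd entries against an all-even triple (`τ = (r, s, t)`, `s, t` odd; `τ′` even): **`eq_add_pow_pred_of_nonunits`**
  (`t = s + N₁`: `τ = s·(N₁−2, 1, N₁+1)`), `factorization_eq_one_or_of_nonunits`, `entries_of_factorization_eq_one` (the entries of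
  valuation `1` of `τ′` lie in `{2s, −2s − N₁}`), **`exceptional_of_nonunits`**: `(wτ, wτ′)` is `((N₁−2,1,N₁+1), (N−4,2,2))`,
  `((N₁−2,1,N₁+1), (N₁,2,N₁−2))` or `((2,N₂−1,3N₂−1), (N−4,2,2))` — list (3).
* §4 Two triples with odd entries: **`first_split_of_units`** (the identity at `s`, `s + N₁`: `t = s + N₁`, or `s′` or `t′` equals
  `N₁ − s`, or `s ∈ {s′, t′}`), **`mixed_of_fibre_neg`** / **`mixed_of_units`** (the configuration `s′ = N₁ − s`: a permutation or
  lists (1)–(2); the sub-case `3 ≤ v(r) ≤ n − 2` dies at the unit `c = (1 − 2^{v(r)−1})s + N₂`), **`exceptional_of_add_pow_pred`** (both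
  triples of shape `(·, s, s + N₁)`: a permutation or the pair `((N₁−2,1,N₁+1), (2,N₂−1,3N₂−1))`, i.e. the stabiliser of
  `H_{(N₁−2,1,N₁+1)}` is `{1, 1+N₁, N₂−1, 3N₂−1}`).
* §5 bookkeeping of the seven pairs; §6 `of_eq_add_pow_pred`, **`perm_or_exceptional_of_units`** (two triples with odd entries: a
  permutation or lists (1)–(2) or the pair `((N₁−2,1,N₁+1), (2,N₂−1,3N₂−1))`).
* §7 **`perm_or_exceptional_of_fermatCMType_eq_twoPow` — THE §5 PROPOSITION FOR EVERY `n ≥ 4`**: a unit among the six entries and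
  `H_{τ′} = H_τ` ⟹ `{τ′} = {τ}`, or for a unit `w` the pair `({wr,ws,wt}, {wr′,ws′,wt′})` — or the exchanged pair — is one of the SEVEN
  pairs `((N−4,1,3), (N₁−2,N₁−1,3))`, `((N−2,1,1), (N₁,1,N₁−1))`, `((N−2,1,1), (2,N₁−1,N₁−1))`, `((N₁−2,1,N₁+1), (N−4,2,2))`,
  `((N₁−2,1,N₁+1), (2,N₂−1,3N₂−1))`, `((N₁−2,1,N₁+1), (N₁,2,N₁−2))`, `((2,N₂−1,3N₂−1), (N−4,2,2))`, each printed in K–R's (1)–(3).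

## Honest column / NOT here

* THE PROOF IS OURS, NOT K–R's: they omit "most of the proof" as similar to Theorem 2 and treat the relatively prime case by the
  Probabilistic Lemma (`n ≥ 9`) plus a computer check (`N ≤ 256`).  Here EVERY case — boundary or not, every `n ≥ 4` — follows from
  the parity criterion (K–R's own §2 character argument at prime-power level, tree) by evaluating it at the units `s`, `s + N₁`,
  `s + N₂`, `t`, `t + N₁`, `s′` and `(1 − 2ᵏ⁻¹)s + N₂`, and using `2s ≢ 0 (mod 4)`.  The cites locate the printed statement.
* The conclusion lists SEVEN pairs; K–R print TEN ("any 2 of"): the other three are `((N₁,1,N₁−1), (2,N₁−1,N₁−1))` =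
  `(N₁−1)·((N₁,N₁−1,1), (N−2,1,1))`, `((N₁,2,N₁−2), (2,N₂−1,3N₂−1))` = `(N₂−1)·((N₁,N₁−2,2), (N₁−2,1,N₁+1))` (reached here through the
  listed pair and the common unit), and `((N−4,2,2), (N₁,2,N₁−2))`, which has no odd entry (excluded by the g.c.d. hypothesis; it is
  the pull-back of `((N₁−2,1,1), (N₂,1,N₂−1))` from level `2ⁿ⁻¹`).  So the typed statement implies the printed one and is sharper by
  this bookkeeping only; a numerical enumeration (`N = 16, …, 128`) confirms that all seven classes occur and no other.
* Only the direction "coincidence ⟹ listed" is typed here; that each listed pair IS a coincidence is in the tree for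
  `((N−4,1,3),(N₁−2,N₁−1,3))`, `((N−2,1,1),(N₁,1,N₁−1))`, `((N₁−2,1,N₁+1),(N−4,2,2))`, `((N₁−2,1,N₁+1),(N₁,2,N₁−2))` (siblings, every `n`)
  and at `N = 8, 16` for the rest; the two stabiliser statements (`N₁ − 1 ∈ W_{(1,1,N−2)}`, `N₂ − 1 ∈ W_{(1,N₁−2,N₁+1)}`) for general
  `n` are NOT typed here.
* `n ≥ 4` as printed (`N = 8`: sibling `exists_unit_of_fermatCMType_eq_eight`); all-even pairs (g.c.d. even) are pull-backs from level
  `2ⁿ⁻¹` (sibling `CyclotomicFermatCMTypesLevelPullback`) and are not treated; "isogeny of lattices" = equality of the residue sets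
  `H_τ` at the full level, as in every sibling (the isogeny form `A_τ ∼ A_{τ′} ⟺ H_{τ′} = H_{uτ}` is the siblings'
  `isIsogenous_fermatCMType_iff_exists_eq_mul`).
* Statements carry `r, s, t ≠ 0` and `r + s + t = 0` (K–R: `1 ≤ r, s, t`, `r + s + t = N`).

## References

* [KoblitzRohrlich1978] N. Koblitz, D. Rohrlich, Canad. J. Math. 30 (1978) 1183–1205: Theorem 4 (p. 1186), §5 Proposition and its
  proof sketch (pp. 1200–1201), Probabilistic Lemma (pp. 1201–1205), §2 (pp. 1187–1188), §3 Case 1 (p. 1193).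

## Provenance

Cell `pub-hodgecm2` (COR-CM), literature seat `lit-deligne-3` gen 38 (claim KR78-THM4-COMPLETE; count-neutral, own lane).
-/

noncomputable section

open NumberField

namespace Literature.AlgebraicGeometry.ComplexMultiplication

open Literature.AlgebraicGeometry.HodgeTheory (fermatCMType)

namespace CyclotomicFermatCMType

/-! ## §1 Arithmetic modulo `2ⁿ`: the residues `N₁ = 2ⁿ⁻¹`, `N₂ = 2ⁿ⁻²`, parities modulo `2` and `4`, valuations -/

section Arithmetic

variable {n : ℕ}

/-- `2ⁿ = 0` modulo `2ⁿ`. [folklore] -/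
private theorem two_pow_self_eq_zero : (2 : ZMod (2 ^ n)) ^ n = 0 := by
  have h := ZMod.natCast_self (2 ^ n)
  push_cast at h
  exact h

/-- `2ʲ = 0` modulo `2ⁿ` for `j ≥ n`. [folklore] -/
private theorem two_pow_eq_zero_of_le {j : ℕ} (hj : n ≤ j) : (2 : ZMod (2 ^ n)) ^ j = 0 := by
  rw [← Nat.add_sub_cancel' hj, pow_add, two_pow_self_eq_zero, zero_mul]

/-- `2ʲ ≠ 0` modulo `2ⁿ` for `j < n` (K–R's `N₁ = 2ⁿ⁻¹`, `N₂ = 2ⁿ⁻²` are non-zero). [cite: KoblitzRohrlich1978, §5 (p. 1200)] -/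
theorem two_pow_ne_zero_of_lt {j : ℕ} (hj : j < n) : (2 : ZMod (2 ^ n)) ^ j ≠ 0 := by
  have h := pow_natCast_ne_zero_of_lt (p := 2) (n := n) hj
  rwa [Nat.cast_ofNat] at h

/-- `2·N₁ = 0` (`N₁ = 2ⁿ⁻¹`, `n ≥ 1`). [cite: KoblitzRohrlich1978, §5 (p. 1200)] -/
theorem two_mul_pow_pred (hn : n ≠ 0) : 2 * (2 : ZMod (2 ^ n)) ^ (n - 1) = 0 := by
  rw [← pow_succ', show n - 1 + 1 = n by omega, two_pow_self_eq_zero]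

/-- `2·N₂ = N₁` (`n ≥ 2`). [cite: KoblitzRohrlich1978, §5 (p. 1200)] -/
theorem two_mul_pow_pred_pred (hn : 2 ≤ n) : 2 * (2 : ZMod (2 ^ n)) ^ (n - 2) = (2 : ZMod (2 ^ n)) ^ (n - 1) := by
  rw [← pow_succ', show n - 2 + 1 = n - 1 by omega]

/-- `2ʲ·N₁ = 0` for `j ≥ 1`. [folklore] -/
private theorem pow_mul_pow_pred_eq_zero {j : ℕ} (hj : 1 ≤ j) :
    (2 : ZMod (2 ^ n)) ^ j * (2 : ZMod (2 ^ n)) ^ (n - 1) = 0 := by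
  rw [← pow_add]; exact two_pow_eq_zero_of_le (by omega)

/-- `2ʲ·N₂ = 0` for `j ≥ 2`. [folklore] -/
private theorem pow_mul_pow_pred_pred_eq_zero {j : ℕ} (hj : 2 ≤ j) :
    (2 : ZMod (2 ^ n)) ^ j * (2 : ZMod (2 ^ n)) ^ (n - 2) = 0 := by
  rw [← pow_add]; exact two_pow_eq_zero_of_le (by omega)

/-- `N₁·y ∈ {0, N₁}` for every residue `y`. [folklore] -/
private theorem pow_pred_mul_eq_zero_or (hn : n ≠ 0) (y : ZMod (2 ^ n)) :
    (2 : ZMod (2 ^ n)) ^ (n - 1) * y = 0 ∨ (2 : ZMod (2 ^ n)) ^ (n - 1) * y = (2 : ZMod (2 ^ n)) ^ (n - 1) := by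
  have ey : y = 2 * ((y.val / 2 : ℕ) : ZMod (2 ^ n)) + ((y.val % 2 : ℕ) : ZMod (2 ^ n)) := by
    conv_lhs => rw [← ZMod.natCast_zmod_val y, ← Nat.div_add_mod y.val 2]
    push_cast; ring
  have h2 : (2 : ZMod (2 ^ n)) ^ (n - 1) * (2 * ((y.val / 2 : ℕ) : ZMod (2 ^ n))) = 0 := by
    rw [← mul_assoc, mul_comm _ (2 : ZMod (2 ^ n)), two_mul_pow_pred hn, zero_mul]
  rcases Nat.mod_two_eq_zero_or_one y.val with h0 | h1
  · left; rw [ey, mul_add, h2, h0, Nat.cast_zero, mul_zero, add_zero]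
  · right; rw [ey, mul_add, h2, h1, Nat.cast_one, mul_one, zero_add]

/-- `N₂·x ∈ {N₂, N₂ + N₁}` for a unit `x` (`n ≥ 2`). [folklore] -/
private theorem pow_pred_pred_mul_of_isUnit (hn : 2 ≤ n) {x : ZMod (2 ^ n)} (hx : IsUnit x) :
    (2 : ZMod (2 ^ n)) ^ (n - 2) * x = (2 : ZMod (2 ^ n)) ^ (n - 2) ∨
      (2 : ZMod (2 ^ n)) ^ (n - 2) * x = (2 : ZMod (2 ^ n)) ^ (n - 2) + (2 : ZMod (2 ^ n)) ^ (n - 1) := by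
  -- `x = 1 + 2y`, `N₂·x = N₂ + N₁·y`
  have hodd : x.val % 2 = 1 := by
    have hc : x.val.Coprime (2 ^ n) := by
      have h := ZMod.isUnit_iff_coprime x.val (2 ^ n)
      rw [ZMod.natCast_zmod_val] at h
      exact h.1 hx
    have h2 : x.val.Coprime 2 := Nat.Coprime.coprime_dvd_right (dvd_pow_self 2 (by omega)) hc
    rcases Nat.mod_two_eq_zero_or_one x.val with h0 | h1
    · exact absurd (Nat.Coprime.eq_one_of_dvd h2.symm (Nat.dvd_of_mod_eq_zero h0)) (by norm_num)
    · exact h1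
  obtain ⟨y, ex⟩ : ∃ y : ZMod (2 ^ n), x = 1 + 2 * y := ⟨((x.val / 2 : ℕ) : ZMod (2 ^ n)), by
    conv_lhs => rw [← ZMod.natCast_zmod_val x, ← Nat.div_add_mod x.val 2, hodd]
    push_cast; ring⟩
  have e : (2 : ZMod (2 ^ n)) ^ (n - 2) * x = (2 : ZMod (2 ^ n)) ^ (n - 2) + (2 : ZMod (2 ^ n)) ^ (n - 1) * y := by
    rw [ex, mul_add, mul_one, ← mul_assoc, mul_comm _ (2 : ZMod (2 ^ n)), two_mul_pow_pred_pred hn]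
  rcases pow_pred_mul_eq_zero_or (by omega) y with h0 | h1
  · left; rw [e, h0, add_zero]
  · right; rw [e, h1]

/-- The valuation of `2ᵏ·u` is `k` (`u` a unit, `k < n`), spelt with the numeral `2`. [cite: KoblitzRohrlich1978, §5 (p. 1200)] -/
theorem factorization_two_pow_mul {k : ℕ} (hk : k < n) {u : ZMod (2 ^ n)} (hu : IsUnit u) :
    ((2 : ZMod (2 ^ n)) ^ k * u).val.factorization 2 = k := by
  have h := factorization_val_pow_mul (p := 2) hk hu
  rwa [Nat.cast_ofNat] at h

/-- `2ᵏ·u ≠ 0` for a unit `u` and `k < n`. [folklore] -/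
private theorem two_pow_mul_ne_zero {k : ℕ} (hk : k < n) {u : ZMod (2 ^ n)} (hu : IsUnit u) : (2 : ZMod (2 ^ n)) ^ k * u ≠ 0 :=
  fun h => two_pow_ne_zero_of_lt hk (hu.mul_left_eq_zero.1 h)

/-- **Valuations separate**: `2ⁱ·u ≠ 2ʲ·u′` for units `u, u′` and `i ≠ j` below `n` ("`ord`" bookkeeping).
[cite: KoblitzRohrlich1978, §4 proof of the Proposition (p. 1198)] -/
theorem two_pow_mul_ne_two_pow_mul {i j : ℕ} (hi : i < n) (hj : j < n) (hij : i ≠ j) {u u' : ZMod (2 ^ n)}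
    (hu : IsUnit u) (hu' : IsUnit u') : (2 : ZMod (2 ^ n)) ^ i * u ≠ (2 : ZMod (2 ^ n)) ^ j * u' := by
  intro h
  have h2 := congrArg (fun z : ZMod (2 ^ n) => z.val.factorization 2) h
  simp only [factorization_two_pow_mul hi hu, factorization_two_pow_mul hj hu'] at h2
  exact hij h2

/-- Every non-zero residue is `2ᵏ·u` with `u` a unit and `k = v(a) < n`, spelt with the numeral `2`.
[cite: KoblitzRohrlich1978, §4 proof of the Proposition (p. 1198)] -/
theorem exists_eq_two_pow_mul_unit {a : ZMod (2 ^ n)} (ha : a ≠ 0) :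
    a.val.factorization 2 < n ∧ ∃ u : ZMod (2 ^ n), IsUnit u ∧ a = (2 : ZMod (2 ^ n)) ^ (a.val.factorization 2) * u := by
  obtain ⟨hk, u, hu, e⟩ := exists_eq_pow_mul_unit_primePow (p := 2) ha
  rw [Nat.cast_ofNat] at e
  exact ⟨hk, u, hu, e⟩

/-- `v(−a) = v(a)`. [folklore] -/
private theorem factorization_val_neg (a : ZMod (2 ^ n)) : (-a).val.factorization 2 = a.val.factorization 2 := by
  by_cases ha : a = 0
  · rw [ha, neg_zero]
  obtain ⟨hk, u, hu, e⟩ := exists_eq_two_pow_mul_unit ha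
  conv_lhs => rw [e, ← mul_neg, factorization_two_pow_mul hk hu.neg]

/-! ### Triples as multisets -/

/-- Transposition of the first two entries of a triple. [folklore] -/
private theorem triple_swap_left {N : ℕ} (a b c : ZMod N) : ({a, b, c} : Multiset (ZMod N)) = {b, a, c} := by
  rw [Multiset.insert_eq_cons, Multiset.insert_eq_cons, Multiset.insert_eq_cons, Multiset.insert_eq_cons, Multiset.cons_swap]

/-- Transposition of the last two entries of a triple. [folklore] -/
private theorem triple_swap_right {N : ℕ} (a b c : ZMod N) : ({a, b, c} : Multiset (ZMod N)) = {a, c, b} := by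
  rw [Multiset.pair_comm b c]

/-- Cyclic rotation of a triple. [folklore] -/
private theorem triple_rotate {N : ℕ} (a b c : ZMod N) : ({a, b, c} : Multiset (ZMod N)) = {c, a, b} := by
  rw [triple_swap_right, triple_swap_left]

/-- The image of a triple under multiplication by `w`. [folklore] -/
private theorem map_mul_triple {N : ℕ} (w x y z : ZMod N) :
    (({x, y, z} : Multiset (ZMod N)).map (fun v => w * v)) = {w * x, w * y, w * z} := by
  simp only [Multiset.insert_eq_cons, Multiset.map_cons, Multiset.map_singleton]

/-- Transport of `{wx, wy, wz}` along an equality of triples. [folklore] -/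
private theorem mul_triple_eq_of_triple_eq {N : ℕ} (w : ZMod N) {x y z x' y' z' : ZMod N}
    (h : ({x, y, z} : Multiset (ZMod N)) = {x', y', z'}) :
    ({w * x, w * y, w * z} : Multiset (ZMod N)) = {w * x', w * y', w * z'} := by
  rw [← map_mul_triple, ← map_mul_triple, h]

/-! ### Reduction modulo `2`: units are the odd residues -/

/-- A residue modulo `2ⁿ` (`n ≥ 1`) is a unit iff its reduction modulo `2` is `1`. [cite: KoblitzRohrlich1978, §5 (p. 1200)] -/
theorem isUnit_iff_castHom_two_eq_one (hn : n ≠ 0) (a : ZMod (2 ^ n)) :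
    IsUnit a ↔ ZMod.castHom (dvd_pow_self 2 hn) (ZMod 2) a = 1 := by
  have key : ∀ z : ZMod 2, z ≠ 0 ↔ z = 1 := by decide
  rw [← key, ← not_iff_not, not_isUnit_iff_castHom_eq_zero (p := 2) hn, not_not]

/-- The reduction of `2` modulo `2` vanishes. [folklore] -/
private theorem castHom_two_two (hn : n ≠ 0) : ZMod.castHom (dvd_pow_self 2 hn) (ZMod 2) (2 : ZMod (2 ^ n)) = 0 := by
  rw [map_ofNat]; rfl

/-- **Two units and a third residue summing to `0` force the third to be a NON-unit** ("at least one component in a triple must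
be even"). [cite: KoblitzRohrlich1978, §5 (p. 1200)] -/
theorem not_isUnit_of_add_units (hn : n ≠ 0) {r s t : ZMod (2 ^ n)} (hs : IsUnit s) (ht : IsUnit t) (hrst : r + s + t = 0) :
    ¬IsUnit r := by
  rw [isUnit_iff_castHom_two_eq_one hn] at hs ht ⊢
  have h := congrArg (ZMod.castHom (dvd_pow_self 2 hn) (ZMod 2)) hrst
  rw [map_add, map_add, hs, ht, map_zero] at h
  intro hr
  rw [hr] at h
  exact absurd h (by decide)

/-- **The two patterns modulo `2ⁿ`**: a triple of non-zero residues with sum `0` has either NO unit entry, or — up to a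
permutation — exactly two unit entries and one non-unit ("there is no 'relatively prime case' … since at least one component in a
triple must be even"). [cite: KoblitzRohrlich1978, §5 (p. 1200)] -/
theorem pattern_of_triple_two (hn : n ≠ 0) {r s t : ZMod (2 ^ n)} (hr0 : r ≠ 0) (hs0 : s ≠ 0) (ht0 : t ≠ 0)
    (hrst : r + s + t = 0) :
    (¬IsUnit r ∧ ¬IsUnit s ∧ ¬IsUnit t) ∨
      ∃ a b c : ZMod (2 ^ n), ({a, b, c} : Multiset (ZMod (2 ^ n))) = {r, s, t} ∧ a ≠ 0 ∧ ¬IsUnit a ∧ IsUnit b ∧ IsUnit c ∧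
        a + b + c = 0 := by
  -- modulo `2` the number of unit entries is even
  have key : ∀ {a b c : ZMod (2 ^ n)}, a + b + c = 0 → IsUnit a → ¬IsUnit b → IsUnit c := by
    intro a b c habc ha hb
    rw [isUnit_iff_castHom_two_eq_one hn] at ha ⊢
    rw [not_isUnit_iff_castHom_eq_zero (p := 2) hn] at hb
    have h := congrArg (ZMod.castHom (dvd_pow_self 2 hn) (ZMod 2)) habc
    rw [map_add, map_add, ha, hb, map_zero, add_zero] at h
    have hc : ∀ z : ZMod 2, 1 + z = 0 → z = 1 := by decide
    exact hc _ h
  have sw₁₂ : ∀ a b c : ZMod (2 ^ n), ({a, b, c} : Multiset (ZMod (2 ^ n))) = {b, a, c} := fun a b c => by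
    rw [Multiset.insert_eq_cons, Multiset.insert_eq_cons, Multiset.insert_eq_cons, Multiset.insert_eq_cons,
      Multiset.cons_swap]
  have sw₂₃ : ∀ a b c : ZMod (2 ^ n), ({a, b, c} : Multiset (ZMod (2 ^ n))) = {a, c, b} := fun a b c => by
    rw [Multiset.pair_comm b c]
  by_cases hr : IsUnit r <;> by_cases hs : IsUnit s <;> by_cases ht : IsUnit t
  · exact absurd hr (not_isUnit_of_add_units hn hs ht hrst)
  · exact Or.inr ⟨t, r, s, by rw [sw₁₂, sw₂₃], ht0, ht, hr, hs, by linear_combination hrst⟩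
  · exact Or.inr ⟨s, r, t, sw₁₂ s r t, hs0, hs, hr, ht, by linear_combination hrst⟩
  · exact absurd (key hrst hr hs) ht
  · exact Or.inr ⟨r, s, t, rfl, hr0, hr, hs, ht, hrst⟩
  · exact absurd (key (show s + t + r = 0 by linear_combination hrst) hs ht) hr
  · exact absurd (key (show t + r + s = 0 by linear_combination hrst) ht hr) hs
  · exact Or.inl ⟨hr, hs, ht⟩

/-! ### Reduction modulo `4`: twice a unit is `2 mod 4` -/

/-- `4 ∣ 2ⁿ` for `n ≥ 2` (K–R's `N₂ = 2ⁿ⁻²` is an integer; reduction modulo `4` below). [cite: KoblitzRohrlich1978, §5 (p. 1200)] -/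
theorem four_dvd_two_pow (hn : 2 ≤ n) : 4 ∣ 2 ^ n := by
  rw [show (4 : ℕ) = 2 ^ 2 by norm_num]; exact pow_dvd_pow 2 hn

/-- The reduction of `2ʲ` modulo `4` vanishes for `j ≥ 2` (so `N₁, N₂ ≡ 0 (mod 4)` once `n ≥ 4`). [folklore] -/
private theorem castHom_four_two_pow (hn : 2 ≤ n) {j : ℕ} (hj : 2 ≤ j) :
    ZMod.castHom (four_dvd_two_pow hn) (ZMod 4) ((2 : ZMod (2 ^ n)) ^ j) = 0 := by
  rw [map_pow, map_ofNat, ← Nat.add_sub_cancel' hj, pow_add, show (2 : ZMod 4) ^ 2 = 0 from by decide, zero_mul]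

/-- **Twice a unit is not a multiple of `4`**: `2s ≠ E` whenever `E ≡ 0 (mod 4)` — the parity bookkeeping "`2 ∣ r`, `4 ∤ r`" behind
every exclusion below. [cite: KoblitzRohrlich1978, §5 (p. 1200)] -/
theorem two_mul_ne_of_castHom_four (hn : 2 ≤ n) {s E : ZMod (2 ^ n)} (hs : IsUnit s)
    (hE : ZMod.castHom (four_dvd_two_pow hn) (ZMod 4) E = 0) : 2 * s ≠ E := by
  intro h
  have hu : IsUnit (ZMod.castHom (four_dvd_two_pow hn) (ZMod 4) s) := hs.map _
  have h2 := congrArg (ZMod.castHom (four_dvd_two_pow hn) (ZMod 4)) h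
  rw [map_mul, map_ofNat, hE] at h2
  obtain ⟨w, hw⟩ := hu.exists_right_inv
  have key : ∀ z w : ZMod 4, 2 * z = 0 → z * w ≠ 1 := by decide
  exact key _ _ h2 hw

end Arithmetic

/-! ## §2 The fibre predicate `2^{v(a)}·y = a` at `p = 2`: unit entries, entries `2c`, the entry `N₁`, periodicity under `+N₁`, `+N₂` -/

section Fibre

variable {n : ℕ}

/-- The reduction of `2ʲ` modulo `2` vanishes for `j ≥ 1` (`N₁`, `N₂` are even). [folklore] -/
private theorem castHom_two_two_pow (hn : n ≠ 0) {j : ℕ} (hj : 1 ≤ j) :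
    ZMod.castHom (dvd_pow_self 2 hn) (ZMod 2) ((2 : ZMod (2 ^ n)) ^ j) = 0 := by
  rw [map_pow, castHom_two_two hn, zero_pow (by omega)]

/-- A unit plus an even residue is a unit (e.g. `s + N₁`, `−s − N₂`). [folklore] -/
private theorem isUnit_of_castHom_two_eq_one (hn : n ≠ 0) {a : ZMod (2 ^ n)}
    (h : ZMod.castHom (dvd_pow_self 2 hn) (ZMod 2) a = 1) : IsUnit a :=
  (isUnit_iff_castHom_two_eq_one hn a).2 h

/-- **A unit entry `a` is counted at `y` iff `y = a`**, spelt with the numeral `2`. [cite: KoblitzRohrlich1978, §2 (p. 1187)] -/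
theorem fibre_iff_of_isUnit (hn : n ≠ 0) {a : ZMod (2 ^ n)} (ha : IsUnit a) (y : ZMod (2 ^ n)) :
    (2 : ZMod (2 ^ n)) ^ (a.val.factorization 2) * y = a ↔ y = a := by
  rw [factorization_val_eq_zero_of_isUnit (p := 2) hn ha, pow_zero, one_mul]

/-- **An entry `a = 2c` (`c` a unit) is counted at `y` iff `y ∈ {c, c + N₁}`** (the fibre of a residue of valuation `1` is a coset of
`{1, 1 + N₁}`; `n ≥ 2`). [cite: KoblitzRohrlich1978, §5 (p. 1201)] -/
theorem fibre_iff_of_eq_two_mul (hn : 2 ≤ n) {a c : ZMod (2 ^ n)} (hc : IsUnit c) (ha : a = 2 * c) (y : ZMod (2 ^ n)) :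
    (2 : ZMod (2 ^ n)) ^ (a.val.factorization 2) * y = a ↔ y = c ∨ y = c + (2 : ZMod (2 ^ n)) ^ (n - 1) := by
  have hv : a.val.factorization 2 = 1 := by
    have h := factorization_two_pow_mul (n := n) (k := 1) (by omega) hc
    rwa [pow_one, ← ha] at h
  rw [hv, pow_one, ha, two_mul_eq_two_mul_iff_twoPow (by omega)]

/-- **The entry `N₁ = 2ⁿ⁻¹` is counted at every unit.** [cite: KoblitzRohrlich1978, §5 (p. 1201)] -/
theorem fibre_of_eq_pow_pred (hn : n ≠ 0) {a : ZMod (2 ^ n)} (ha : a = (2 : ZMod (2 ^ n)) ^ (n - 1)) {y : ZMod (2 ^ n)}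
    (hy : IsUnit y) : ((2 : ZMod (2 ^ n)) ^ (a.val.factorization 2) * y = a) = True := by
  rw [eq_iff_iff, iff_true]
  have hv : a.val.factorization 2 = n - 1 := by
    have h := factorization_two_pow_mul (n := n) (k := n - 1) (by omega) isUnit_one
    rwa [mul_one, ← ha] at h
  rw [hv, ha]
  exact pow_pred_mul_eq_of_isUnit_twoPow hn hy

/-- A NON-unit non-zero entry `a` has `2^{v(a)}·N₁ = 0` (`v(a) ≥ 1`). [folklore] -/
private theorem two_pow_factorization_mul_pow_pred {a : ZMod (2 ^ n)} (ha : a ≠ 0) (hau : ¬IsUnit a) :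
    (2 : ZMod (2 ^ n)) ^ (a.val.factorization 2) * (2 : ZMod (2 ^ n)) ^ (n - 1) = 0 :=
  pow_mul_pow_pred_eq_zero (factorization_val_pos_of_not_isUnit (p := 2) ha hau)

/-- An entry of valuation `≥ 2` has `2^{v(a)}·N₂ = 0`. [folklore] -/
private theorem two_pow_factorization_mul_pow_pred_pred {a : ZMod (2 ^ n)} (h2 : 2 ≤ a.val.factorization 2) :
    (2 : ZMod (2 ^ n)) ^ (a.val.factorization 2) * (2 : ZMod (2 ^ n)) ^ (n - 2) = 0 :=
  pow_mul_pow_pred_pred_eq_zero h2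

/-- **Periodicity of the fibre of an even entry**: if `2^{v(a)}·d = 0` then `a` is counted at `y + d` iff at `y` (used with `d = N₁`
for every even entry and `d = N₂` for entries of valuation `≥ 2` — K–R's "`⟨ur⟩ = r` for `u ∈ P`").
[cite: KoblitzRohrlich1978, §3 proof of the Proposition, Case 1 (p. 1193)] -/
theorem fibre_add_iff {a d : ZMod (2 ^ n)} (hd : (2 : ZMod (2 ^ n)) ^ (a.val.factorization 2) * d = 0) (y : ZMod (2 ^ n)) :
    (2 : ZMod (2 ^ n)) ^ (a.val.factorization 2) * (y + d) = a ↔ (2 : ZMod (2 ^ n)) ^ (a.val.factorization 2) * y = a := by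
  rw [mul_add, hd, add_zero]

/-- The same periodicity at the opposite point `−(y + d)`. [cite: KoblitzRohrlich1978, §3 proof of the Proposition, Case 1 (p. 1193)] -/
theorem fibre_neg_add_iff {a d : ZMod (2 ^ n)} (hd : (2 : ZMod (2 ^ n)) ^ (a.val.factorization 2) * d = 0) (y : ZMod (2 ^ n)) :
    (2 : ZMod (2 ^ n)) ^ (a.val.factorization 2) * -(y + d) = a ↔ (2 : ZMod (2 ^ n)) ^ (a.val.factorization 2) * -y = a := by
  rw [neg_add, mul_add, mul_neg _ d, hd, neg_zero, add_zero]

/-- The fibre predicate of `−a` at `y` is that of `a` at `−y` (`v(−a) = v(a)`). [folklore] -/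
private theorem fibre_neg_iff (a y : ZMod (2 ^ n)) :
    (2 : ZMod (2 ^ n)) ^ ((-a).val.factorization 2) * y = -a ↔ (2 : ZMod (2 ^ n)) ^ (a.val.factorization 2) * -y = a := by
  rw [factorization_val_neg, mul_neg, neg_eq_iff_eq_neg]

/-- **An entry counted at `y` and at `−y` is `N₁`** (its fibre is stable under `−1` only if `v(a) = n − 1`): for `a ≠ 0` and a unit
`y`, `2^{v(a)}y = a = 2^{v(a)}(−y)` forces `a = N₁`. [cite: KoblitzRohrlich1978, §5 (p. 1201)] -/
theorem eq_pow_pred_of_fibre_of_fibre_neg (hn : n ≠ 0) {a y : ZMod (2 ^ n)} (ha : a ≠ 0) (hy : IsUnit y)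
    (h1 : (2 : ZMod (2 ^ n)) ^ (a.val.factorization 2) * y = a) (h2 : (2 : ZMod (2 ^ n)) ^ (a.val.factorization 2) * -y = a) :
    a = (2 : ZMod (2 ^ n)) ^ (n - 1) := by
  obtain ⟨hk, u, hu, e⟩ := exists_eq_two_pow_mul_unit ha
  set k := a.val.factorization 2 with hk_def
  -- `2^{k+1}·y = 0`, so `k + 1 ≥ n`
  have h3 : (2 : ZMod (2 ^ n)) ^ (k + 1) * y = 0 := by
    rw [pow_succ, mul_assoc, two_mul, ← sub_eq_zero, mul_add]
    linear_combination h1 - h2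
  have hk1 : n ≤ k + 1 := by
    by_contra hlt
    exact two_pow_mul_ne_zero (by omega) hy h3
  have hkn : k = n - 1 := by omega
  rw [← h1, hkn]
  exact pow_pred_mul_eq_of_isUnit_twoPow hn hy

end Fibre

/-! ## §3 A triple with two odd entries against an ALL-EVEN triple: `τ ∼ (N₁ − 2, 1, N₁ + 1)` and `τ′` is one of three triples -/

section MixedPattern

variable {n : ℕ}

/-- **Step 1: `t = s + N₁`.**  Let `τ = (r, s, t)` have `s, t` odd and let `τ′ = (a, b, c)` consist of non-zero EVEN residues, sums
`0`, `H_{τ′} = H_τ` (`n ≥ 4`).  Comparing the parity identity at `x = s` and at `x = s + N₁` — every fibre term of an even entry is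
`N₁`-periodic — leaves `1 + [s = t] + [t = −s − N₁] = [t = s + N₁]`, whence `t = s + N₁`: `τ = s·(N₁ − 2, 1, N₁ + 1)` is a unit
multiple of K–R's triple `(N₁ − 2, 1, N₁ + 1)` of list (3). [cite: KoblitzRohrlich1978, §5 Proposition, list (3) (p. 1200)] -/
theorem eq_add_pow_pred_of_nonunits (hn : 4 ≤ n) {r s t a b c : ZMod (2 ^ n)}
    (hr : r ≠ 0) (hs : IsUnit s) (ht : IsUnit t) (hrst : r + s + t = 0)
    (ha : a ≠ 0) (hb : b ≠ 0) (hc : c ≠ 0) (hau : ¬IsUnit a) (hbu : ¬IsUnit b) (hcu : ¬IsUnit c)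
    (habc : a + b + c = 0) (heq : fermatCMType (2 ^ n) a b c = fermatCMType (2 ^ n) r s t) :
    t = s + (2 : ZMod (2 ^ n)) ^ (n - 1) := by
  classical
  have hn0 : n ≠ 0 := by omega
  have hn2 : 2 ≤ n := by omega
  haveI : Fact (1 < 2 ^ n) := ⟨Nat.one_lt_pow hn0 (by norm_num)⟩
  set N₁ : ZMod (2 ^ n) := (2 : ZMod (2 ^ n)) ^ (n - 1) with hN₁
  set π₄ := ZMod.castHom (four_dvd_two_pow hn2) (ZMod 4) with hπ₄
  have hπ0 : π₄ 0 = 0 := map_zero π₄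
  have hπ₁ : π₄ N₁ = 0 := castHom_four_two_pow hn2 (by omega)
  have hru : ¬IsUnit r := not_isUnit_of_add_units hn0 hs ht hrst
  have hsN : IsUnit (s + N₁) := isUnit_of_castHom_two_eq_one hn0 (by
    rw [map_add, (isUnit_iff_castHom_two_eq_one hn0 s).1 hs, hN₁, castHom_two_two_pow hn0 (by omega), add_zero])
  -- `N₁`-periodicity of the fibres of the even entries
  have hdN : ∀ {e : ZMod (2 ^ n)}, e ≠ 0 → ¬IsUnit e → (2 : ZMod (2 ^ n)) ^ (e.val.factorization 2) * N₁ = 0 :=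
    fun he heu => two_pow_factorization_mul_pow_pred he heu
  -- exclusions
  have f1 : ¬(-s = s) := fun h => two_mul_ne_of_castHom_four hn2 hs hπ0 (by linear_combination -h)
  have f2 : ¬(-s = t) := fun h => hr (by linear_combination hrst + h)
  have f3 : ¬(s + N₁ = s) := fun h => two_pow_ne_zero_of_lt (n := n) (j := n - 1) (by omega) (by linear_combination h)
  have f4 : ¬(-(s + N₁) = s) := fun h =>
    two_mul_ne_of_castHom_four hn2 hs (E := -N₁) (by rw [map_neg, hπ₁, neg_zero]) (by linear_combination -h)
  by_contra hne
  have f5 : ¬(s + N₁ = t) := fun h => hne h.symm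
  have h1 := countP_add_countP_eq_of_fermatCMType_eq (p := 2) hn0 hr hs.ne_zero ht.ne_zero hrst ha hb hc habc heq hs
  have h2 := countP_add_countP_eq_of_fermatCMType_eq (p := 2) hn0 hr hs.ne_zero ht.ne_zero hrst ha hb hc habc heq hsN
  simp only [Multiset.insert_eq_cons, ← Multiset.cons_zero, Multiset.countP_cons, Multiset.countP_zero, zero_add,
    Nat.cast_ofNat, fibre_iff_of_isUnit hn0 hs, fibre_iff_of_isUnit hn0 ht,
    fibre_add_iff (hdN hr hru), fibre_neg_add_iff (hdN hr hru), fibre_add_iff (hdN ha hau), fibre_neg_add_iff (hdN ha hau),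
    fibre_add_iff (hdN hb hbu), fibre_neg_add_iff (hdN hb hbu), fibre_add_iff (hdN hc hcu), fibre_neg_add_iff (hdN hc hcu),
    f1, f2, f3, f4, f5, if_true, if_false, add_zero] at h1 h2
  have b1 : (if s = t then 1 else 0 : ℕ) ≤ 1 := by split_ifs <;> omega
  have b2 : (if -(s + N₁) = t then 1 else 0 : ℕ) ≤ 1 := by split_ifs <;> omega
  omega

/-- **Step 2: `τ′` has an entry of valuation `1`.**  With `τ = (r, s, s + N₁)` (so `r = 2(−s − N₂)`) and `τ′ = (a, b, c)` even and
non-zero: if all three entries of `τ′` had valuation `≥ 2`, their fibres would be `N₂`-periodic, while the parity identity at `x = s`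
and at `x = s + N₂` differ by `2` on the side of `τ` (the fibre `{−s − N₂, −s + N₂}` of `r` contains `−(s + N₂)` but not `−s`).
[cite: KoblitzRohrlich1978, §5 Proposition, list (3) (p. 1200)] -/
theorem factorization_eq_one_or_of_nonunits (hn : 4 ≤ n) {r s a b c : ZMod (2 ^ n)} (hr : r ≠ 0) (hs : IsUnit s)
    (hrst : r + s + (s + (2 : ZMod (2 ^ n)) ^ (n - 1)) = 0)
    (ha : a ≠ 0) (hb : b ≠ 0) (hc : c ≠ 0) (hau : ¬IsUnit a) (hbu : ¬IsUnit b) (hcu : ¬IsUnit c) (habc : a + b + c = 0)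
    (heq : fermatCMType (2 ^ n) a b c = fermatCMType (2 ^ n) r s (s + (2 : ZMod (2 ^ n)) ^ (n - 1))) :
    a.val.factorization 2 = 1 ∨ b.val.factorization 2 = 1 ∨ c.val.factorization 2 = 1 := by
  classical
  have hn0 : n ≠ 0 := by omega
  have hn2 : 2 ≤ n := by omega
  haveI : Fact (1 < 2 ^ n) := ⟨Nat.one_lt_pow hn0 (by norm_num)⟩
  set N₁ : ZMod (2 ^ n) := (2 : ZMod (2 ^ n)) ^ (n - 1) with hN₁
  set N₂ : ZMod (2 ^ n) := (2 : ZMod (2 ^ n)) ^ (n - 2) with hN₂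
  set π₄ := ZMod.castHom (four_dvd_two_pow hn2) (ZMod 4) with hπ₄
  have hπ₁ : π₄ N₁ = 0 := castHom_four_two_pow hn2 (by omega)
  have hπ₂ : π₄ N₂ = 0 := castHom_four_two_pow hn2 (by omega)
  have hX : ∀ E : ZMod (2 ^ n), π₄ E = 0 → 2 * s = E → False := fun E hE h => two_mul_ne_of_castHom_four hn2 hs hE h
  have e2N₂ : 2 * N₂ = N₁ := two_mul_pow_pred_pred hn2
  have hN₂0 : N₂ ≠ 0 := two_pow_ne_zero_of_lt (by omega)
  have hN₁0 : N₁ ≠ 0 := two_pow_ne_zero_of_lt (by omega)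
  have hN₂1 : N₂ ≠ N₁ := fun h => hN₂0 (by linear_combination e2N₂ - h)
  -- units and the shape of `r`
  have h2s : ZMod.castHom (dvd_pow_self 2 hn0) (ZMod 2) s = 1 := (isUnit_iff_castHom_two_eq_one hn0 s).1 hs
  have h2N₁ : ZMod.castHom (dvd_pow_self 2 hn0) (ZMod 2) N₁ = 0 := castHom_two_two_pow hn0 (by omega)
  have h2N₂ : ZMod.castHom (dvd_pow_self 2 hn0) (ZMod 2) N₂ = 0 := castHom_two_two_pow hn0 (by omega)
  have hsN₂ : IsUnit (s + N₂) := isUnit_of_castHom_two_eq_one hn0 (by rw [map_add, h2s, h2N₂, add_zero])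
  have hc₀ : IsUnit (-s - N₂) := isUnit_of_castHom_two_eq_one hn0 (by rw [map_sub, map_neg, h2s, h2N₂, sub_zero]; decide)
  have hr2 : r = 2 * (-s - N₂) := by linear_combination hrst + e2N₂
  -- suppose all valuations are `≥ 2`
  by_contra hnot
  simp only [not_or] at hnot
  obtain ⟨hva, hvb, hvc⟩ := hnot
  have h2a : 2 ≤ a.val.factorization 2 := by have := factorization_val_pos_of_not_isUnit (p := 2) ha hau; omega
  have h2b : 2 ≤ b.val.factorization 2 := by have := factorization_val_pos_of_not_isUnit (p := 2) hb hbu; omega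
  have h2c : 2 ≤ c.val.factorization 2 := by have := factorization_val_pos_of_not_isUnit (p := 2) hc hcu; omega
  -- exclusions at `x = s` and `x = s + N₂`
  have g1 : ¬(s = -s - N₂) := fun h => hX (-N₂) (by simp [hπ₂]) (by linear_combination h)
  have g2 : ¬(s = -s - N₂ + N₁) := fun h => hX (-N₂ + N₁) (by simp [hπ₁, hπ₂]) (by linear_combination h)
  have g3 : ¬(s = s + N₁) := fun h => hN₁0 (by linear_combination -h)
  have g4 : ¬(-s = -s - N₂) := fun h => hN₂0 (by linear_combination h)
  have g5 : ¬(-s = -s - N₂ + N₁) := fun h => hN₂1 (by linear_combination h)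
  have g6 : ¬(-s = s) := fun h => hX 0 (map_zero _) (by linear_combination -h)
  have g7 : ¬(-s = s + N₁) := fun h => hX (-N₁) (by simp [hπ₁]) (by linear_combination -h)
  have g8 : ¬(s + N₂ = -s - N₂) := fun h => hX (-N₁) (by simp [hπ₁]) (by linear_combination h - e2N₂)
  have g9 : ¬(s + N₂ = -s - N₂ + N₁) := fun h => hX 0 (map_zero _) (by linear_combination h - e2N₂)
  have g10 : ¬(s + N₂ = s) := fun h => hN₂0 (by linear_combination h)
  have g11 : ¬(s + N₂ = s + N₁) := fun h => hN₂1 (by linear_combination h)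
  have gT : -(s + N₂) = -s - N₂ ∨ -(s + N₂) = -s - N₂ + N₁ := Or.inl (by ring)
  have g12 : ¬(-(s + N₂) = s) := fun h => hX (-N₂) (by simp [hπ₂]) (by linear_combination -h)
  have g13 : ¬(-(s + N₂) = s + N₁) := fun h => hX (-N₂ - N₁) (by simp [hπ₁, hπ₂]) (by linear_combination -h)
  have hdN₂ : ∀ {e : ZMod (2 ^ n)}, 2 ≤ e.val.factorization 2 → (2 : ZMod (2 ^ n)) ^ (e.val.factorization 2) * N₂ = 0 :=
    fun he => two_pow_factorization_mul_pow_pred_pred he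
  have hsN : IsUnit (s + N₁) := isUnit_of_castHom_two_eq_one hn0 (by rw [map_add, h2s, h2N₁, add_zero])
  have h1 := countP_add_countP_eq_of_fermatCMType_eq (p := 2) hn0 hr hs.ne_zero hsN.ne_zero hrst ha hb hc habc heq hs
  have h2 := countP_add_countP_eq_of_fermatCMType_eq (p := 2) hn0 hr hs.ne_zero hsN.ne_zero hrst ha hb hc habc heq hsN₂
  simp only [Multiset.insert_eq_cons, ← Multiset.cons_zero, Multiset.countP_cons, Multiset.countP_zero, zero_add,
    Nat.cast_ofNat, fibre_iff_of_isUnit hn0 hs, fibre_iff_of_isUnit hn0 hsN, fibre_iff_of_eq_two_mul hn2 hc₀ hr2,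
    fibre_add_iff (hdN₂ h2a), fibre_neg_add_iff (hdN₂ h2a), fibre_add_iff (hdN₂ h2b), fibre_neg_add_iff (hdN₂ h2b),
    fibre_add_iff (hdN₂ h2c), fibre_neg_add_iff (hdN₂ h2c),
    ← hN₁, g1, g2, g3, g4, g5, g6, g7, g8, g9, g10, g11, gT, g12, g13, or_self, if_true, if_false, add_zero,
    zero_add] at h1 h2
  omega

/-- **Step 3: the two entries of valuation `1` lie in `{2s, −2s − N₁}`.**  With `τ = (r, s, s + N₁)` and `τ′ = (a, b, c)` even,
non-zero, `v(a) = v(b) = 1` (then `v(c) ≥ 2`): writing `a = 2α`, `b = 2β`, the parity identity at `x = s` and at `x = s + N₂` gives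
`[s ∈ αU₁] + [−s−N₂ ∈ αU₁] + [s ∈ βU₁] + [−s−N₂ ∈ βU₁] = 2 + (four more brackets)` (`U₁ = {1, 1 + N₁}`), and `s`, `−s − N₂` cannot both
lie in one coset `αU₁` (`2s ≢ 0 mod 4`); hence `α, β ∈ {s, s + N₁, −s − N₂, −s + N₂}`, i.e. `a, b ∈ {2s, −2s − N₁}`.
[cite: KoblitzRohrlich1978, §5 Proposition, list (3) (p. 1200)] -/
theorem entries_of_factorization_eq_one (hn : 4 ≤ n) {r s a b c : ZMod (2 ^ n)} (hr : r ≠ 0) (hs : IsUnit s)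
    (hrst : r + s + (s + (2 : ZMod (2 ^ n)) ^ (n - 1)) = 0)
    (ha : a ≠ 0) (hb : b ≠ 0) (hc : c ≠ 0) (hcu : ¬IsUnit c) (habc : a + b + c = 0)
    (heq : fermatCMType (2 ^ n) a b c = fermatCMType (2 ^ n) r s (s + (2 : ZMod (2 ^ n)) ^ (n - 1)))
    (hva : a.val.factorization 2 = 1) (hvb : b.val.factorization 2 = 1) :
    (a = 2 * s ∨ a = -(2 * s) - (2 : ZMod (2 ^ n)) ^ (n - 1)) ∧ (b = 2 * s ∨ b = -(2 * s) - (2 : ZMod (2 ^ n)) ^ (n - 1)) := by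
  classical
  have hn0 : n ≠ 0 := by omega
  have hn2 : 2 ≤ n := by omega
  haveI : Fact (1 < 2 ^ n) := ⟨Nat.one_lt_pow hn0 (by norm_num)⟩
  set N₁ : ZMod (2 ^ n) := (2 : ZMod (2 ^ n)) ^ (n - 1) with hN₁
  set N₂ : ZMod (2 ^ n) := (2 : ZMod (2 ^ n)) ^ (n - 2) with hN₂
  set π₄ := ZMod.castHom (four_dvd_two_pow hn2) (ZMod 4) with hπ₄
  have hπ₁ : π₄ N₁ = 0 := castHom_four_two_pow hn2 (by omega)
  have hπ₂ : π₄ N₂ = 0 := castHom_four_two_pow hn2 (by omega)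
  have hX : ∀ E : ZMod (2 ^ n), π₄ E = 0 → 2 * s = E → False := fun E hE h => two_mul_ne_of_castHom_four hn2 hs hE h
  have e2N₂ : 2 * N₂ = N₁ := two_mul_pow_pred_pred hn2
  have e2N₁ : 2 * N₁ = 0 := two_mul_pow_pred hn0
  have hN₂0 : N₂ ≠ 0 := two_pow_ne_zero_of_lt (by omega)
  have hN₁0 : N₁ ≠ 0 := two_pow_ne_zero_of_lt (by omega)
  have hN₂1 : N₂ ≠ N₁ := fun h => hN₂0 (by linear_combination e2N₂ - h)
  -- units and the shape of `r`, `a`, `b`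
  have h2s : ZMod.castHom (dvd_pow_self 2 hn0) (ZMod 2) s = 1 := (isUnit_iff_castHom_two_eq_one hn0 s).1 hs
  have h2N₁ : ZMod.castHom (dvd_pow_self 2 hn0) (ZMod 2) N₁ = 0 := castHom_two_two_pow hn0 (by omega)
  have h2N₂ : ZMod.castHom (dvd_pow_self 2 hn0) (ZMod 2) N₂ = 0 := castHom_two_two_pow hn0 (by omega)
  have hsN : IsUnit (s + N₁) := isUnit_of_castHom_two_eq_one hn0 (by rw [map_add, h2s, h2N₁, add_zero])
  have hsN₂ : IsUnit (s + N₂) := isUnit_of_castHom_two_eq_one hn0 (by rw [map_add, h2s, h2N₂, add_zero])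
  have hc₀ : IsUnit (-s - N₂) := isUnit_of_castHom_two_eq_one hn0 (by rw [map_sub, map_neg, h2s, h2N₂, sub_zero]; decide)
  have hr2 : r = 2 * (-s - N₂) := by linear_combination hrst + e2N₂
  obtain ⟨-, α, hα, ha2⟩ := exists_eq_two_pow_mul_unit ha
  rw [hva, pow_one] at ha2
  obtain ⟨-, β, hβ, hb2⟩ := exists_eq_two_pow_mul_unit hb
  rw [hvb, pow_one] at hb2
  -- `v(c) ≥ 2`: otherwise `c = 2γ` with `γ` odd and `α + β + γ ∈ {0, N₁}` would be even
  have h2c : 2 ≤ c.val.factorization 2 := by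
    have h1c := factorization_val_pos_of_not_isUnit (p := 2) hc hcu
    by_contra hlt
    have hvc : c.val.factorization 2 = 1 := by omega
    obtain ⟨-, γ, hγ, hc2⟩ := exists_eq_two_pow_mul_unit hc
    rw [hvc, pow_one] at hc2
    have hsum : 2 * (α + β + γ) = 0 := by rw [mul_add, mul_add, ← ha2, ← hb2, ← hc2, habc]
    have h2α := (isUnit_iff_castHom_two_eq_one hn0 α).1 hα
    have h2β := (isUnit_iff_castHom_two_eq_one hn0 β).1 hβ
    have h2γ := (isUnit_iff_castHom_two_eq_one hn0 γ).1 hγ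
    have key : ZMod.castHom (dvd_pow_self 2 hn0) (ZMod 2) (α + β + γ) = 0 := by
      rcases (two_mul_eq_zero_iff_twoPow hn0 _).1 hsum with h0 | h0 <;> rw [h0]
      · exact map_zero _
      · exact h2N₁
    rw [map_add, map_add, h2α, h2β, h2γ] at key
    exact absurd key (by decide)
  have hdN₂ : (2 : ZMod (2 ^ n)) ^ (c.val.factorization 2) * N₂ = 0 := two_pow_factorization_mul_pow_pred_pred h2c
  -- exclusions at `x = s` and `x = s + N₂`
  have g1 : ¬(s = -s - N₂) := fun h => hX (-N₂) (by simp [hπ₂]) (by linear_combination h)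
  have g2 : ¬(s = -s - N₂ + N₁) := fun h => hX (-N₂ + N₁) (by simp [hπ₁, hπ₂]) (by linear_combination h)
  have g3 : ¬(s = s + N₁) := fun h => hN₁0 (by linear_combination -h)
  have g4 : ¬(-s = -s - N₂) := fun h => hN₂0 (by linear_combination h)
  have g5 : ¬(-s = -s - N₂ + N₁) := fun h => hN₂1 (by linear_combination h)
  have g6 : ¬(-s = s) := fun h => hX 0 (map_zero _) (by linear_combination -h)
  have g7 : ¬(-s = s + N₁) := fun h => hX (-N₁) (by simp [hπ₁]) (by linear_combination -h)
  have g8 : ¬(s + N₂ = -s - N₂) := fun h => hX (-N₁) (by simp [hπ₁]) (by linear_combination h - e2N₂)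
  have g9 : ¬(s + N₂ = -s - N₂ + N₁) := fun h => hX 0 (map_zero _) (by linear_combination h - e2N₂)
  have g10 : ¬(s + N₂ = s) := fun h => hN₂0 (by linear_combination h)
  have g11 : ¬(s + N₂ = s + N₁) := fun h => hN₂1 (by linear_combination h)
  have gT : -(s + N₂) = -s - N₂ ∨ -(s + N₂) = -s - N₂ + N₁ := Or.inl (by ring)
  have g12 : ¬(-(s + N₂) = s) := fun h => hX (-N₂) (by simp [hπ₂]) (by linear_combination -h)
  have g13 : ¬(-(s + N₂) = s + N₁) := fun h => hX (-N₂ - N₁) (by simp [hπ₁, hπ₂]) (by linear_combination -h)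
  -- `s` and `−s − N₂` are not in one coset `{δ, δ + N₁}`
  have excl : ∀ {δ : ZMod (2 ^ n)}, (s = δ ∨ s = δ + N₁) → (-(s + N₂) = δ ∨ -(s + N₂) = δ + N₁) → False := by
    rintro δ (h₁ | h₁) (h₂ | h₂)
    · exact hX (-N₂) (by simp [hπ₂]) (by linear_combination h₁ - h₂)
    · exact hX (-N₂ - N₁) (by simp [hπ₁, hπ₂]) (by linear_combination h₁ - h₂)
    · exact hX (-N₂ + N₁) (by simp [hπ₁, hπ₂]) (by linear_combination h₁ - h₂)
    · exact hX (-N₂) (by simp [hπ₂]) (by linear_combination h₁ - h₂)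
  have bα : (if s = α ∨ s = α + N₁ then 1 else 0 : ℕ) + (if -(s + N₂) = α ∨ -(s + N₂) = α + N₁ then 1 else 0 : ℕ) ≤ 1 := by
    split_ifs with h₁ h₂ <;> first | exact (excl h₁ h₂).elim | omega
  have bβ : (if s = β ∨ s = β + N₁ then 1 else 0 : ℕ) + (if -(s + N₂) = β ∨ -(s + N₂) = β + N₁ then 1 else 0 : ℕ) ≤ 1 := by
    split_ifs with h₁ h₂ <;> first | exact (excl h₁ h₂).elim | omega
  have h1 := countP_add_countP_eq_of_fermatCMType_eq (p := 2) hn0 hr hs.ne_zero hsN.ne_zero hrst ha hb hc habc heq hs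
  have h2 := countP_add_countP_eq_of_fermatCMType_eq (p := 2) hn0 hr hs.ne_zero hsN.ne_zero hrst ha hb hc habc heq hsN₂
  simp only [Multiset.insert_eq_cons, ← Multiset.cons_zero, Multiset.countP_cons, Multiset.countP_zero, zero_add,
    Nat.cast_ofNat, fibre_iff_of_isUnit hn0 hs, fibre_iff_of_isUnit hn0 hsN, fibre_iff_of_eq_two_mul hn2 hc₀ hr2,
    fibre_iff_of_eq_two_mul hn2 hα ha2, fibre_iff_of_eq_two_mul hn2 hβ hb2, fibre_add_iff hdN₂, fibre_neg_add_iff hdN₂,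
    ← hN₁, g1, g2, g3, g4, g5, g6, g7, g8, g9, g10, g11, gT, g12, g13, or_self, if_true, if_false, add_zero,
    zero_add] at h1 h2
  -- from the two identities: each of `α`, `β` has `s` or `−s − N₂` in its coset
  have conclude : ∀ {δ e : ZMod (2 ^ n)}, e = 2 * δ →
      ((s = δ ∨ s = δ + N₁) ∨ (-(s + N₂) = δ ∨ -(s + N₂) = δ + N₁)) → (e = 2 * s ∨ e = -(2 * s) - N₁) := by
    rintro δ e he ((h | h) | (h | h))
    · exact Or.inl (by linear_combination he - 2 * h)
    · exact Or.inl (by linear_combination he - 2 * h - e2N₁)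
    · exact Or.inr (by linear_combination he - 2 * h - e2N₂)
    · exact Or.inr (by linear_combination he - 2 * h - e2N₂ - e2N₁)
  constructor
  · refine conclude ha2 ?_
    by_contra hnot
    obtain ⟨hA1, hA4⟩ := not_or.1 hnot
    rw [if_neg hA1] at h1
    rw [if_neg hA4] at h2
    omega
  · refine conclude hb2 ?_
    by_contra hnot
    obtain ⟨hB1, hB4⟩ := not_or.1 hnot
    rw [if_neg hB1] at h1
    rw [if_neg hB4] at h2
    omega

/-- **Step 4 (the values).**  With `τ = (r, s, s + N₁)`, `τ′ = (a, b, c)` and `a, b ∈ {2s, −2s − N₁}`: for the unit `w = s⁻¹`,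
`wτ = (N₁ − 2, 1, N₁ + 1)` and `wτ′` is a permutation of `(N − 4, 2, 2)` or of `(N₁, 2, N₁ − 2)`, or — when `a = b = −2s − N₁`,
replacing `w` by `(3N₂ − 1)w` — `wτ, wτ′` are permutations of `(2, N₂ − 1, 3N₂ − 1)`, `(N − 4, 2, 2)`: pairs of K–R's list (3).
[cite: KoblitzRohrlich1978, §5 Proposition, list (3) (p. 1200)] -/
theorem exceptional_of_entries (hn : 4 ≤ n) {r s a b c : ZMod (2 ^ n)} (hs : IsUnit s)
    (hrst : r + s + (s + (2 : ZMod (2 ^ n)) ^ (n - 1)) = 0) (habc : a + b + c = 0)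
    (hab : (a = 2 * s ∨ a = -(2 * s) - (2 : ZMod (2 ^ n)) ^ (n - 1)) ∧ (b = 2 * s ∨ b = -(2 * s) - (2 : ZMod (2 ^ n)) ^ (n - 1))) :
    ∃ w : ZMod (2 ^ n), IsUnit w ∧
      ((({w * r, w * s, w * (s + (2 : ZMod (2 ^ n)) ^ (n - 1))} : Multiset (ZMod (2 ^ n))) =
            {(2 : ZMod (2 ^ n)) ^ (n - 1) - 2, 1, (2 : ZMod (2 ^ n)) ^ (n - 1) + 1} ∧
          ({w * a, w * b, w * c} : Multiset (ZMod (2 ^ n))) = {-4, 2, 2}) ∨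
        (({w * r, w * s, w * (s + (2 : ZMod (2 ^ n)) ^ (n - 1))} : Multiset (ZMod (2 ^ n))) =
            {(2 : ZMod (2 ^ n)) ^ (n - 1) - 2, 1, (2 : ZMod (2 ^ n)) ^ (n - 1) + 1} ∧
          ({w * a, w * b, w * c} : Multiset (ZMod (2 ^ n))) = {(2 : ZMod (2 ^ n)) ^ (n - 1), 2, (2 : ZMod (2 ^ n)) ^ (n - 1) - 2}) ∨
        (({w * r, w * s, w * (s + (2 : ZMod (2 ^ n)) ^ (n - 1))} : Multiset (ZMod (2 ^ n))) =
            {2, (2 : ZMod (2 ^ n)) ^ (n - 2) - 1, 3 * (2 : ZMod (2 ^ n)) ^ (n - 2) - 1} ∧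
          ({w * a, w * b, w * c} : Multiset (ZMod (2 ^ n))) = {-4, 2, 2})) := by
  have hn0 : n ≠ 0 := by omega
  have hn2 : 2 ≤ n := by omega
  set N₁ : ZMod (2 ^ n) := (2 : ZMod (2 ^ n)) ^ (n - 1) with hN₁
  set N₂ : ZMod (2 ^ n) := (2 : ZMod (2 ^ n)) ^ (n - 2) with hN₂
  have e2N₁ : 2 * N₁ = 0 := two_mul_pow_pred hn0
  have e2N₂ : 2 * N₂ = N₁ := two_mul_pow_pred_pred hn2
  have eN₁N₂ : N₁ * N₂ = 0 := by rw [hN₁, mul_comm]; exact pow_mul_pow_pred_eq_zero (by omega)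
  have eN₂N₂ : N₂ * N₂ = 0 := by rw [hN₂]; exact pow_mul_pow_pred_pred_eq_zero (by omega)
  -- the unit `w = s⁻¹`
  obtain ⟨w, hw⟩ := hs.exists_left_inv
  have hwu : IsUnit w := IsUnit.of_mul_eq_one s hw
  have hwN₁ : w * N₁ = N₁ := by rw [mul_comm]; exact pow_pred_mul_eq_of_isUnit_twoPow hn0 hwu
  have hr : r = -(2 * s) - N₁ := by linear_combination hrst
  have hτ : ({w * r, w * s, w * (s + N₁)} : Multiset (ZMod (2 ^ n))) = {N₁ - 2, 1, N₁ + 1} := by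
    rw [show w * r = N₁ - 2 by rw [hr]; linear_combination -2 * hw - hwN₁ - e2N₁, hw,
      show w * (s + N₁) = N₁ + 1 by linear_combination hw + hwN₁]
  have v1 : w * (2 * s) = 2 := by linear_combination 2 * hw
  have v2 : w * (-(2 * s) - N₁) = N₁ - 2 := by linear_combination -2 * hw - hwN₁ - e2N₁
  obtain ⟨ha | ha, hb | hb⟩ := hab
  · -- `τ′ = (2s, 2s, −4s)`
    have hc : c = -(4 * s) := by linear_combination habc - ha - hb
    refine ⟨w, hwu, Or.inl ⟨hτ, ?_⟩⟩
    rw [ha, hb, hc, v1, show w * -(4 * s) = -4 by linear_combination -4 * hw, triple_rotate]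
  · -- `τ′ = (2s, −2s − N₁, N₁)`
    have hc : c = N₁ := by linear_combination habc - ha - hb
    refine ⟨w, hwu, Or.inr (Or.inl ⟨hτ, ?_⟩)⟩
    rw [ha, hb, hc, v1, v2, hwN₁, triple_rotate]
  · -- `τ′ = (−2s − N₁, 2s, N₁)`
    have hc : c = N₁ := by linear_combination habc - ha - hb
    refine ⟨w, hwu, Or.inr (Or.inl ⟨hτ, ?_⟩)⟩
    rw [ha, hb, hc, v1, v2, hwN₁, triple_rotate, triple_swap_right]
  · -- `τ′ = (−2s − N₁, −2s − N₁, 4s)`: use the unit `(3N₂ − 1)w`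
    have hc : c = 4 * s := by linear_combination habc - ha - hb + e2N₁
    have h2u : ZMod.castHom (dvd_pow_self 2 hn0) (ZMod 2) (3 * N₂ - 1) = 1 := by
      rw [map_sub, map_mul, map_one, hN₂, castHom_two_two_pow hn0 (by omega), mul_zero, zero_sub]; decide
    have hu : IsUnit ((3 * N₂ - 1) * w) := (isUnit_of_castHom_two_eq_one hn0 h2u).mul hwu
    refine ⟨(3 * N₂ - 1) * w, hu, Or.inr (Or.inr ⟨?_, ?_⟩)⟩
    · rw [mul_assoc, mul_assoc, mul_assoc, show w * r = N₁ - 2 by rw [hr]; linear_combination -2 * hw - hwN₁ - e2N₁, hw,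
        show w * (s + N₁) = N₁ + 1 by linear_combination hw + hwN₁,
        show (3 * N₂ - 1) * (N₁ - 2) = 2 by linear_combination 3 * eN₁N₂ - 3 * e2N₂ - 2 * e2N₁, mul_one,
        show (3 * N₂ - 1) * (N₁ + 1) = N₂ - 1 by linear_combination 3 * eN₁N₂ + e2N₂, triple_swap_right]
    · rw [mul_assoc, mul_assoc, mul_assoc, ha, hb, hc, v2, show w * (4 * s) = 4 by linear_combination 4 * hw,
        show (3 * N₂ - 1) * (N₁ - 2) = 2 by linear_combination 3 * eN₁N₂ - 3 * e2N₂ - 2 * e2N₁,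
        show (3 * N₂ - 1) * 4 = -4 by linear_combination 6 * e2N₂ + 3 * e2N₁, triple_rotate]

/-- **The partner of an entry of valuation `1` in an even triple**: if `a + b + c = 0` with `a, b, c` even and non-zero and `v(a) = 1`,
then `v(b) = 1` or `v(c) = 1` (modulo `4`: `2 + 0 + 0 ≠ 0`). [cite: KoblitzRohrlich1978, §5 (p. 1200)] -/
theorem factorization_eq_one_of_partner (hn : 2 ≤ n) {a b c : ZMod (2 ^ n)} (ha : a ≠ 0) (hb : b ≠ 0) (hc : c ≠ 0)
    (hbu : ¬IsUnit b) (hcu : ¬IsUnit c) (habc : a + b + c = 0) (hva : a.val.factorization 2 = 1) :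
    b.val.factorization 2 = 1 ∨ c.val.factorization 2 = 1 := by
  by_contra hnot
  obtain ⟨hvb, hvc⟩ := not_or.1 hnot
  have h2b : 2 ≤ b.val.factorization 2 := by have := factorization_val_pos_of_not_isUnit (p := 2) hb hbu; omega
  have h2c : 2 ≤ c.val.factorization 2 := by have := factorization_val_pos_of_not_isUnit (p := 2) hc hcu; omega
  obtain ⟨-, α, hα, ha2⟩ := exists_eq_two_pow_mul_unit ha
  rw [hva, pow_one] at ha2
  obtain ⟨-, β, -, hb2⟩ := exists_eq_two_pow_mul_unit hb
  obtain ⟨-, γ, -, hc2⟩ := exists_eq_two_pow_mul_unit hc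
  refine two_mul_ne_of_castHom_four hn hα (E := -(b + c)) ?_ (by linear_combination habc - ha2)
  rw [map_neg, map_add, hb2, hc2, map_mul, map_mul, castHom_four_two_pow hn h2b, castHom_four_two_pow hn h2c, zero_mul,
    zero_mul, add_zero, neg_zero]

/-- **TWO ODD ENTRIES AGAINST AN ALL-EVEN TRIPLE (list (3) of the §5 Proposition).**  Let `N = 2ⁿ`, `n ≥ 4`, `τ = (r, s, t)` with
`s, t` odd, `τ′ = (a, b, c)` with all entries even, all six entries non-zero, `r + s + t = 0 = a + b + c`, and `H_{τ′} = H_τ`.  Then for a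
unit `w`, `(wτ, wτ′)` is — up to permutations within the triples — one of the pairs `((N₁−2, 1, N₁+1), (N−4, 2, 2))`,
`((N₁−2, 1, N₁+1), (N₁, 2, N₁−2))`, `((2, N₂−1, 3N₂−1), (N−4, 2, 2))` of K–R's list (3) (`N₁ = 2ⁿ⁻¹`, `N₂ = 2ⁿ⁻²`; the fourth printed
triple pairing, `(N−4,2,2)` with `(N₁,2,N₁−2)`, has no odd entry).  Steps 1–4 above.
[cite: KoblitzRohrlich1978, §5 Proposition, list (3) (p. 1200)] -/
theorem exceptional_of_nonunits (hn : 4 ≤ n) {r s t a b c : ZMod (2 ^ n)}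
    (hr : r ≠ 0) (hs : IsUnit s) (ht : IsUnit t) (hrst : r + s + t = 0)
    (ha : a ≠ 0) (hb : b ≠ 0) (hc : c ≠ 0) (hau : ¬IsUnit a) (hbu : ¬IsUnit b) (hcu : ¬IsUnit c)
    (habc : a + b + c = 0) (heq : fermatCMType (2 ^ n) a b c = fermatCMType (2 ^ n) r s t) :
    ∃ w : ZMod (2 ^ n), IsUnit w ∧
      ((({w * r, w * s, w * t} : Multiset (ZMod (2 ^ n))) = {(2 : ZMod (2 ^ n)) ^ (n - 1) - 2, 1, (2 : ZMod (2 ^ n)) ^ (n - 1) + 1} ∧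
          ({w * a, w * b, w * c} : Multiset (ZMod (2 ^ n))) = {-4, 2, 2}) ∨
        (({w * r, w * s, w * t} : Multiset (ZMod (2 ^ n))) = {(2 : ZMod (2 ^ n)) ^ (n - 1) - 2, 1, (2 : ZMod (2 ^ n)) ^ (n - 1) + 1} ∧
          ({w * a, w * b, w * c} : Multiset (ZMod (2 ^ n))) = {(2 : ZMod (2 ^ n)) ^ (n - 1), 2, (2 : ZMod (2 ^ n)) ^ (n - 1) - 2}) ∨
        (({w * r, w * s, w * t} : Multiset (ZMod (2 ^ n))) = {2, (2 : ZMod (2 ^ n)) ^ (n - 2) - 1, 3 * (2 : ZMod (2 ^ n)) ^ (n - 2) - 1} ∧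
          ({w * a, w * b, w * c} : Multiset (ZMod (2 ^ n))) = {-4, 2, 2})) := by
  have hn2 : 2 ≤ n := by omega
  have hts := eq_add_pow_pred_of_nonunits hn hr hs ht hrst ha hb hc hau hbu hcu habc heq
  subst hts
  -- the core: the first two entries of (a permutation of) `τ′` have valuation `1`
  have key : ∀ {a' b' c' : ZMod (2 ^ n)}, ({a', b', c'} : Multiset (ZMod (2 ^ n))) = {a, b, c} →
      a' ≠ 0 → b' ≠ 0 → c' ≠ 0 → ¬IsUnit c' → a' + b' + c' = 0 →
      a'.val.factorization 2 = 1 → b'.val.factorization 2 = 1 →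
      ∃ w : ZMod (2 ^ n), IsUnit w ∧
        ((({w * r, w * s, w * (s + (2 : ZMod (2 ^ n)) ^ (n - 1))} : Multiset (ZMod (2 ^ n))) =
              {(2 : ZMod (2 ^ n)) ^ (n - 1) - 2, 1, (2 : ZMod (2 ^ n)) ^ (n - 1) + 1} ∧
            ({w * a, w * b, w * c} : Multiset (ZMod (2 ^ n))) = {-4, 2, 2}) ∨
          (({w * r, w * s, w * (s + (2 : ZMod (2 ^ n)) ^ (n - 1))} : Multiset (ZMod (2 ^ n))) =
              {(2 : ZMod (2 ^ n)) ^ (n - 1) - 2, 1, (2 : ZMod (2 ^ n)) ^ (n - 1) + 1} ∧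
            ({w * a, w * b, w * c} : Multiset (ZMod (2 ^ n))) =
              {(2 : ZMod (2 ^ n)) ^ (n - 1), 2, (2 : ZMod (2 ^ n)) ^ (n - 1) - 2}) ∨
          (({w * r, w * s, w * (s + (2 : ZMod (2 ^ n)) ^ (n - 1))} : Multiset (ZMod (2 ^ n))) =
              {2, (2 : ZMod (2 ^ n)) ^ (n - 2) - 1, 3 * (2 : ZMod (2 ^ n)) ^ (n - 2) - 1} ∧
            ({w * a, w * b, w * c} : Multiset (ZMod (2 ^ n))) = {-4, 2, 2})) := by
    intro a' b' c' hperm ha' hb' hc' hc'u habc' hva' hvb'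
    have heq' : fermatCMType (2 ^ n) a' b' c' = fermatCMType (2 ^ n) r s (s + (2 : ZMod (2 ^ n)) ^ (n - 1)) :=
      (fermatCMType_eq_of_multiset_eq hperm).trans heq
    have hab := entries_of_factorization_eq_one hn hr hs hrst ha' hb' hc' hc'u habc' heq' hva' hvb'
    obtain ⟨w, hw, h⟩ := exceptional_of_entries hn hs hrst habc' hab
    refine ⟨w, hw, ?_⟩
    rw [mul_triple_eq_of_triple_eq w hperm] at h
    exact h
  rcases factorization_eq_one_or_of_nonunits hn hr hs hrst ha hb hc hau hbu hcu habc heq with hva | hvb | hvc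
  · rcases factorization_eq_one_of_partner hn2 ha hb hc hbu hcu habc hva with hvb | hvc
    · exact key rfl ha hb hc hcu habc hva hvb
    · exact key (triple_swap_right a c b) ha hc hb hbu (by linear_combination habc) hva hvc
  · rcases factorization_eq_one_of_partner hn2 hb ha hc hau hcu (by linear_combination habc) hvb with hva | hvc
    · exact key rfl ha hb hc hcu habc hva hvb
    · exact key (triple_rotate b c a) hb hc ha hau (by linear_combination habc) hvb hvc
  · rcases factorization_eq_one_of_partner hn2 hc ha hb hau hbu (by linear_combination habc) hvc with hva | hvb
    · exact key (triple_swap_right a c b) ha hc hb hbu (by linear_combination habc) hva hvc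
    · exact key (triple_rotate b c a) hb hc ha hau (by linear_combination habc) hvb hvc

end MixedPattern

/-! ## §4 Two triples with odd entries `s, t` and `s′, t′`: the unit parts must match up to the translation by `N₁` -/

section OddOdd

variable {n : ℕ}

/-- **First split.**  Let `τ = (r, s, t)`, `τ′ = (r′, s′, t′)` have `s, t, s′, t′` odd (`r, r′ ≠ 0` even), sums `0`, `H_{τ′} = H_τ`
(`n ≥ 4`).  Comparing the parity identity at `x = s` and `x = s + N₁` (the fibres of `r, r′` are `N₁`-periodic):
`1 + [s=t] + [−s=s′] + [−s=t′] + [−s−N₁=t] + [s+N₁=s′] + [s+N₁=t′] = [s=s′] + [s=t′] + [s+N₁=t] + [−s−N₁=s′] + [−s−N₁=t′]`; hence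
`t = s + N₁`, or `s′ = N₁ − s`, or `t′ = N₁ − s`, or `s ∈ {s′, t′}` (with `s′ = t′ = s` if `s = t`).
[cite: KoblitzRohrlich1978, §5 Proposition (p. 1200) and §2 (p. 1188, "{r,s,t} = {⟨±r′⟩, ⟨±s′⟩, ⟨±t′⟩}")] -/
theorem first_split_of_units (hn : 4 ≤ n) {r s t r' s' t' : ZMod (2 ^ n)}
    (hr : r ≠ 0) (hs : IsUnit s) (ht : IsUnit t) (hrst : r + s + t = 0)
    (hr' : r' ≠ 0) (hs' : IsUnit s') (ht' : IsUnit t') (hrst' : r' + s' + t' = 0)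
    (heq : fermatCMType (2 ^ n) r' s' t' = fermatCMType (2 ^ n) r s t) :
    s + (2 : ZMod (2 ^ n)) ^ (n - 1) = t ∨ -(s + (2 : ZMod (2 ^ n)) ^ (n - 1)) = s' ∨ -(s + (2 : ZMod (2 ^ n)) ^ (n - 1)) = t' ∨
      ((s = s' ∨ s = t') ∧ (s = t → s = s' ∧ s = t')) := by
  classical
  have hn0 : n ≠ 0 := by omega
  have hn2 : 2 ≤ n := by omega
  haveI : Fact (1 < 2 ^ n) := ⟨Nat.one_lt_pow hn0 (by norm_num)⟩
  set N₁ : ZMod (2 ^ n) := (2 : ZMod (2 ^ n)) ^ (n - 1) with hN₁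
  set π₄ := ZMod.castHom (four_dvd_two_pow hn2) (ZMod 4) with hπ₄
  have hπ₁ : π₄ N₁ = 0 := castHom_four_two_pow hn2 (by omega)
  have hX : ∀ E : ZMod (2 ^ n), π₄ E = 0 → 2 * s = E → False := fun E hE h => two_mul_ne_of_castHom_four hn2 hs hE h
  have hN₁0 : N₁ ≠ 0 := two_pow_ne_zero_of_lt (by omega)
  have hru : ¬IsUnit r := not_isUnit_of_add_units hn0 hs ht hrst
  have hr'u : ¬IsUnit r' := not_isUnit_of_add_units hn0 hs' ht' hrst'
  have h2s : ZMod.castHom (dvd_pow_self 2 hn0) (ZMod 2) s = 1 := (isUnit_iff_castHom_two_eq_one hn0 s).1 hs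
  have h2N₁ : ZMod.castHom (dvd_pow_self 2 hn0) (ZMod 2) N₁ = 0 := castHom_two_two_pow hn0 (by omega)
  have hsN : IsUnit (s + N₁) := isUnit_of_castHom_two_eq_one hn0 (by rw [map_add, h2s, h2N₁, add_zero])
  have hdN : ∀ {e : ZMod (2 ^ n)}, e ≠ 0 → ¬IsUnit e → (2 : ZMod (2 ^ n)) ^ (e.val.factorization 2) * N₁ = 0 :=
    fun he heu => two_pow_factorization_mul_pow_pred he heu
  have f1 : ¬(-s = s) := fun h => hX 0 (map_zero _) (by linear_combination -h)
  have f2 : ¬(-s = t) := fun h => hr (by linear_combination hrst + h)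
  have f3 : ¬(s + N₁ = s) := fun h => hN₁0 (by linear_combination h)
  have f4 : ¬(-(s + N₁) = s) := fun h => hX (-N₁) (by simp [hπ₁]) (by linear_combination -h)
  have h1 := countP_add_countP_eq_of_fermatCMType_eq (p := 2) hn0 hr hs.ne_zero ht.ne_zero hrst hr' hs'.ne_zero ht'.ne_zero
    hrst' heq hs
  have h2 := countP_add_countP_eq_of_fermatCMType_eq (p := 2) hn0 hr hs.ne_zero ht.ne_zero hrst hr' hs'.ne_zero ht'.ne_zero
    hrst' heq hsN
  simp only [Multiset.insert_eq_cons, ← Multiset.cons_zero, Multiset.countP_cons, Multiset.countP_zero, zero_add,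
    Nat.cast_ofNat, fibre_iff_of_isUnit hn0 hs, fibre_iff_of_isUnit hn0 ht, fibre_iff_of_isUnit hn0 hs',
    fibre_iff_of_isUnit hn0 ht', fibre_add_iff (hdN hr hru), fibre_neg_add_iff (hdN hr hru), fibre_add_iff (hdN hr' hr'u),
    fibre_neg_add_iff (hdN hr' hr'u), f1, f2, f3, f4, if_true, if_false, add_zero, zero_add] at h1 h2
  have b1 : (if s = t then 1 else 0 : ℕ) ≤ 1 := by split_ifs <;> omega
  have b2 : (if s = s' then 1 else 0 : ℕ) ≤ 1 := by split_ifs <;> omega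
  have b3 : (if s = t' then 1 else 0 : ℕ) ≤ 1 := by split_ifs <;> omega
  have b4 : (if -(s + N₁) = t then 1 else 0 : ℕ) ≤ 1 := by split_ifs <;> omega
  have b5 : (if s + N₁ = s' then 1 else 0 : ℕ) ≤ 1 := by split_ifs <;> omega
  have b6 : (if s + N₁ = t' then 1 else 0 : ℕ) ≤ 1 := by split_ifs <;> omega
  by_contra hnot
  simp only [not_or] at hnot
  obtain ⟨hA, hB, hC, hD⟩ := hnot
  rw [if_neg hA, if_neg hB, if_neg hC] at h2
  apply hD
  constructor
  · by_contra hnot'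
    obtain ⟨h5, h6⟩ := not_or.1 hnot'
    rw [if_neg h5, if_neg h6] at h1
    omega
  · intro hst
    rw [if_pos hst] at h1
    by_contra hnot'
    rcases not_and_or.1 hnot' with h5 | h5
    · rw [if_neg h5] at h1
      omega
    · rw [if_neg h5] at h1
      omega

/-- **The mixed configuration `s′ = N₁ − s`, `t′ = t`, with `r` counted at `−s`.**  Let `τ = (r, s, t)`, `τ′ = (r′, N₁ − s, t)`
(`s, t` odd, sums `0`, `H_{τ′} = H_τ`, `n ≥ 4`) and suppose `2^{v(r)}(−s) = r`, i.e. `r = −2ᵏs`, `t = (2ᵏ − 1)s` with `k = v(r)`.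
Then: `k = 1` gives `τ = s(N−2, 1, 1)`, `τ′ = s(N₁, N₁−1, 1)` (list (2)); `k = 2` gives `τ = s(N−4, 1, 3)`, `τ′ = s(N₁−2, N₁−1, 3)`
(list (1)); `k = n − 1` gives `τ = s(N₁, 1, N₁−1)`, `τ′ = s(2, N₁−1, N₁−1)`, i.e. `((N₁−1)/s)·(τ, τ′) = ((N₁, N₁−1, 1), (N−2, 1, 1))`
(list (2)); and `3 ≤ k ≤ n − 2` is impossible — the parity identity at the unit `c = (1 − 2ᵏ⁻¹)s + N₂` (where `r′ = 2c`) reads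
`0 = 1 + [2^{k}(−c) = r]`. [cite: KoblitzRohrlich1978, §5 Proposition, lists (1)–(2) (p. 1200)] -/
theorem mixed_of_fibre_neg (hn : 4 ≤ n) {r s t r' : ZMod (2 ^ n)}
    (hr : r ≠ 0) (hs : IsUnit s) (ht : IsUnit t) (hrst : r + s + t = 0)
    (hr' : r' ≠ 0) (hrst' : r' + (-s + (2 : ZMod (2 ^ n)) ^ (n - 1)) + t = 0)
    (heq : fermatCMType (2 ^ n) r' (-s + (2 : ZMod (2 ^ n)) ^ (n - 1)) t = fermatCMType (2 ^ n) r s t)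
    (hF : (2 : ZMod (2 ^ n)) ^ (r.val.factorization 2) * -s = r) :
    ({r', -s + (2 : ZMod (2 ^ n)) ^ (n - 1), t} : Multiset (ZMod (2 ^ n))) = {r, s, t} ∨
      ∃ w : ZMod (2 ^ n), IsUnit w ∧
        (((({w * r, w * s, w * t} : Multiset (ZMod (2 ^ n))) = {-4, 1, 3} ∧
              ({w * r', w * (-s + (2 : ZMod (2 ^ n)) ^ (n - 1)), w * t} : Multiset (ZMod (2 ^ n))) =
                {(2 : ZMod (2 ^ n)) ^ (n - 1) - 2, (2 : ZMod (2 ^ n)) ^ (n - 1) - 1, 3}) ∨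
            (({w * r, w * s, w * t} : Multiset (ZMod (2 ^ n))) =
                {(2 : ZMod (2 ^ n)) ^ (n - 1) - 2, (2 : ZMod (2 ^ n)) ^ (n - 1) - 1, 3} ∧
              ({w * r', w * (-s + (2 : ZMod (2 ^ n)) ^ (n - 1)), w * t} : Multiset (ZMod (2 ^ n))) = {-4, 1, 3})) ∨
          ((({w * r, w * s, w * t} : Multiset (ZMod (2 ^ n))) = {-2, 1, 1} ∧
              ({w * r', w * (-s + (2 : ZMod (2 ^ n)) ^ (n - 1)), w * t} : Multiset (ZMod (2 ^ n))) =
                {(2 : ZMod (2 ^ n)) ^ (n - 1), 1, (2 : ZMod (2 ^ n)) ^ (n - 1) - 1}) ∨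
            (({w * r, w * s, w * t} : Multiset (ZMod (2 ^ n))) =
                {(2 : ZMod (2 ^ n)) ^ (n - 1), 1, (2 : ZMod (2 ^ n)) ^ (n - 1) - 1} ∧
              ({w * r', w * (-s + (2 : ZMod (2 ^ n)) ^ (n - 1)), w * t} : Multiset (ZMod (2 ^ n))) = {-2, 1, 1})) ∨
          ((({w * r, w * s, w * t} : Multiset (ZMod (2 ^ n))) = {-2, 1, 1} ∧
              ({w * r', w * (-s + (2 : ZMod (2 ^ n)) ^ (n - 1)), w * t} : Multiset (ZMod (2 ^ n))) =
                {2, (2 : ZMod (2 ^ n)) ^ (n - 1) - 1, (2 : ZMod (2 ^ n)) ^ (n - 1) - 1}) ∨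
            (({w * r, w * s, w * t} : Multiset (ZMod (2 ^ n))) =
                {2, (2 : ZMod (2 ^ n)) ^ (n - 1) - 1, (2 : ZMod (2 ^ n)) ^ (n - 1) - 1} ∧
              ({w * r', w * (-s + (2 : ZMod (2 ^ n)) ^ (n - 1)), w * t} : Multiset (ZMod (2 ^ n))) = {-2, 1, 1}))) := by
  classical
  have hn0 : n ≠ 0 := by omega
  have hn2 : 2 ≤ n := by omega
  haveI : Fact (1 < 2 ^ n) := ⟨Nat.one_lt_pow hn0 (by norm_num)⟩
  set N₁ : ZMod (2 ^ n) := (2 : ZMod (2 ^ n)) ^ (n - 1) with hN₁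
  set N₂ : ZMod (2 ^ n) := (2 : ZMod (2 ^ n)) ^ (n - 2) with hN₂
  have e2N₁ : 2 * N₁ = 0 := two_mul_pow_pred hn0
  have e2N₂ : 2 * N₂ = N₁ := two_mul_pow_pred_pred hn2
  have eN₁sq : N₁ * N₁ = 0 := by rw [hN₁]; exact pow_mul_pow_pred_eq_zero (by omega)
  have hN₁s : N₁ * s = N₁ := pow_pred_mul_eq_of_isUnit_twoPow hn0 hs
  have h2s : ZMod.castHom (dvd_pow_self 2 hn0) (ZMod 2) s = 1 := (isUnit_iff_castHom_two_eq_one hn0 s).1 hs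
  have h2N₁ : ZMod.castHom (dvd_pow_self 2 hn0) (ZMod 2) N₁ = 0 := castHom_two_two_pow hn0 (by omega)
  have h2N₂ : ZMod.castHom (dvd_pow_self 2 hn0) (ZMod 2) N₂ = 0 := castHom_two_two_pow hn0 (by omega)
  have h22 : ZMod.castHom (dvd_pow_self 2 hn0) (ZMod 2) 2 = 0 := castHom_two_two hn0
  have hs'u : IsUnit (-s + N₁) := isUnit_of_castHom_two_eq_one hn0 (by rw [map_add, map_neg, h2s, h2N₁, add_zero]; decide)
  have hru : ¬IsUnit r := not_isUnit_of_add_units hn0 hs ht hrst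
  -- the unit `w = s⁻¹`
  obtain ⟨w, hw⟩ := hs.exists_left_inv
  have hwu : IsUnit w := IsUnit.of_mul_eq_one s hw
  have hwN₁ : w * N₁ = N₁ := by rw [mul_comm]; exact pow_pred_mul_eq_of_isUnit_twoPow hn0 hwu
  -- `k = v(r)`, `r = −2ᵏs`, `t = (2ᵏ − 1)s`
  obtain ⟨k, hk⟩ : ∃ k, r.val.factorization 2 = k := ⟨_, rfl⟩
  have hk1 : 1 ≤ k := hk ▸ factorization_val_pos_of_not_isUnit (p := 2) hr hru
  have hkn : k < n := hk ▸ (exists_eq_two_pow_mul_unit hr).1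
  rw [hk] at hF
  have htk : t = (2 : ZMod (2 ^ n)) ^ k * s - s := by linear_combination hrst + hF
  rcases (by omega : k = 1 ∨ k = 2 ∨ (3 ≤ k ∧ k ≤ n - 2) ∨ k = n - 1) with hk1 | hk2 | ⟨hk3, hkn2⟩ | hkn1
  · -- `k = 1`: list (2), `(N−2, 1, 1)` with `(N₁, 1, N₁−1)`
    rw [hk1, pow_one] at hF htk
    have ht1 : t = s := by linear_combination htk
    have hr1 : r' = -N₁ := by linear_combination hrst' - ht1
    have p1 : w * r = -2 := by linear_combination (-w) * hF - 2 * hw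
    have p3 : w * t = 1 := by rw [ht1, hw]
    have p4 : w * r' = N₁ := by rw [hr1]; linear_combination -hwN₁ - e2N₁
    have p5 : w * (-s + N₁) = N₁ - 1 := by linear_combination -hw + hwN₁
    refine Or.inr ⟨w, hwu, Or.inr (Or.inl (Or.inl ⟨?_, ?_⟩))⟩
    · rw [p1, hw, p3]
    · rw [p4, p5, p3]; exact triple_swap_right _ _ _
  · -- `k = 2`: list (1), `(N−4, 1, 3)` with `(N₁−2, N₁−1, 3)`
    rw [hk2] at hF htk
    have ht3 : t = 3 * s := by linear_combination htk
    have hr2 : r' = -(2 * s) - N₁ := by linear_combination hrst' - ht3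
    have p1 : w * r = -4 := by linear_combination (-w) * hF - 4 * hw
    have p3 : w * t = 3 := by rw [ht3]; linear_combination 3 * hw
    have p4 : w * r' = N₁ - 2 := by rw [hr2]; linear_combination -2 * hw - hwN₁ - e2N₁
    have p5 : w * (-s + N₁) = N₁ - 1 := by linear_combination -hw + hwN₁
    refine Or.inr ⟨w, hwu, Or.inl (Or.inl ⟨?_, ?_⟩)⟩
    · rw [p1, hw, p3]
    · rw [p4, p5, p3]
  · -- `3 ≤ k ≤ n − 2`: impossible, by the parity identity at `c = (1 − 2ᵏ⁻¹)s + N₂`, `r′ = 2c`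
    exfalso
    set π₄ := ZMod.castHom (four_dvd_two_pow hn2) (ZMod 4) with hπ₄
    have hπ₁ : π₄ N₁ = 0 := castHom_four_two_pow hn2 (by omega)
    obtain ⟨c, hc⟩ : ∃ c : ZMod (2 ^ n), c = (1 - (2 : ZMod (2 ^ n)) ^ (k - 1)) * s + N₂ := ⟨_, rfl⟩
    have hcU : IsUnit c := isUnit_of_castHom_two_eq_one hn0 (by
      rw [hc, map_add, map_mul, map_sub, map_one, map_pow, h22, zero_pow (by omega : k - 1 ≠ 0), sub_zero, one_mul, h2s,
        h2N₂, add_zero])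
    have hu₁ : IsUnit ((1 - (2 : ZMod (2 ^ n)) ^ (k - 2)) * s) := isUnit_of_castHom_two_eq_one hn0 (by
      rw [map_mul, map_sub, map_one, map_pow, h22, zero_pow (by omega : k - 2 ≠ 0), sub_zero, one_mul, h2s])
    have hu₂ : IsUnit (((2 : ZMod (2 ^ n)) ^ (k - 2) - 1) * s) := isUnit_of_castHom_two_eq_one hn0 (by
      rw [map_mul, map_sub, map_one, map_pow, h22, zero_pow (by omega : k - 2 ≠ 0), zero_sub, h2s]; decide)
    have h3u : IsUnit (3 : ZMod (2 ^ n)) := isUnit_of_castHom_two_eq_one hn0 (by rw [map_ofNat]; decide)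
    have e2k : (2 : ZMod (2 ^ n)) * 2 ^ (k - 1) = 2 ^ k := by rw [← pow_succ', Nat.sub_add_cancel hk1]
    have ek2 : (2 : ZMod (2 ^ n)) * 2 ^ (k - 2) = 2 ^ (k - 1) := by rw [← pow_succ']; congr 1; omega
    have e2k' : (2 : ZMod (2 ^ n)) ^ k * 2 = 2 ^ (k + 1) := (pow_succ 2 k).symm
    have epow : (2 : ZMod (2 ^ n)) ^ k * 2 ^ (k - 1) = 2 ^ (k + 1) * 2 ^ (k - 2) := by
      rw [← pow_add, ← pow_add]; congr 1; omega
    have hkN₂ : (2 : ZMod (2 ^ n)) ^ k * N₂ = 0 := by rw [hN₂]; exact pow_mul_pow_pred_pred_eq_zero (by omega)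
    have hr'c : r' = 2 * c := by rw [hc]; linear_combination hrst' - htk + s * e2k - e2N₂ - e2N₁
    -- exclusions at `x = c`
    have gcs : ¬(c = s) := fun h => two_pow_mul_ne_two_pow_mul (i := k - 1) (j := n - 2) (by omega) (by omega) (by omega)
      hs isUnit_one (by rw [mul_one]; linear_combination -h + hc)
    have gcs' : ¬(-c = -s + N₁) := fun h => two_pow_mul_ne_two_pow_mul (i := k - 1) (j := n - 2) (by omega) (by omega)
      (by omega) hs h3u (by linear_combination h + hc - e2N₂)
    have gncs : ¬(-c = s) := fun h => two_pow_mul_ne_two_pow_mul (i := 1) (j := n - 2) (by omega) (by omega) (by omega)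
      hu₂ isUnit_one (by rw [pow_one, mul_one]; linear_combination h + hc + s * ek2)
    have gcs'' : ¬(c = -s + N₁) := fun h => two_pow_mul_ne_two_pow_mul (i := 1) (j := n - 2) (by omega) (by omega)
      (by omega) hu₁ isUnit_one (by rw [pow_one, mul_one]; linear_combination h - hc - s * ek2 - e2N₂)
    have gc1 : ¬(-c = c) := fun h => two_mul_ne_of_castHom_four hn2 hcU (E := 0) (map_zero _) (by linear_combination -h)
    have gc2 : ¬(-c = c + N₁) := fun h =>
      two_mul_ne_of_castHom_four hn2 hcU (E := -N₁) (by rw [map_neg, hπ₁, neg_zero]) (by linear_combination -h)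
    have gFc : ¬((2 : ZMod (2 ^ n)) ^ k * c = r) := by
      intro h
      have h0 : (2 : ZMod (2 ^ n)) ^ (k + 1) * ((1 - (2 : ZMod (2 ^ n)) ^ (k - 2)) * s) = 0 := by
        linear_combination h - hF - (2 : ZMod (2 ^ n)) ^ k * hc - hkN₂ - s * e2k' + s * epow
      exact two_pow_mul_ne_zero (by omega) hu₁ h0
    have h := countP_add_countP_eq_of_fermatCMType_eq (p := 2) hn0 hr hs.ne_zero ht.ne_zero hrst hr' hs'u.ne_zero
      ht.ne_zero hrst' heq hcU
    simp only [Multiset.insert_eq_cons, ← Multiset.cons_zero, Multiset.countP_cons, Multiset.countP_zero, zero_add,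
      Nat.cast_ofNat, hk, fibre_iff_of_isUnit hn0 hs, fibre_iff_of_isUnit hn0 ht, fibre_iff_of_isUnit hn0 hs'u,
      fibre_iff_of_eq_two_mul hn2 hcU hr'c, ← hN₁, gcs, gcs', gncs, gcs'', gc1, gc2, gFc, true_or, or_self, if_true,
      if_false, add_zero, zero_add] at h
    omega
  · -- `k = n − 1`: list (2) again, `((N₁−1)/s)·(τ, τ′) = ((N₁, N₁−1, 1), (N−2, 1, 1))`
    rw [hkn1] at hF htk
    rw [← hN₁] at hF htk
    have hrN : r = N₁ := by linear_combination -hF - hN₁s - e2N₁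
    have htN : t = -s + N₁ := by linear_combination htk + hN₁s
    have hr'N : r' = 2 * s := by linear_combination hrst' - htN - e2N₁
    have h2u : ZMod.castHom (dvd_pow_self 2 hn0) (ZMod 2) (N₁ - 1) = 1 := by rw [map_sub, map_one, h2N₁, zero_sub]; decide
    have hu : IsUnit ((N₁ - 1) * w) := (isUnit_of_castHom_two_eq_one hn0 h2u).mul hwu
    have q1 : (N₁ - 1) * w * r = N₁ := by rw [hrN]; linear_combination (N₁ - 1) * hwN₁ + eN₁sq - e2N₁
    have q2 : (N₁ - 1) * w * s = N₁ - 1 := by linear_combination (N₁ - 1) * hw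
    have q5 : (N₁ - 1) * w * (-s + N₁) = 1 := by linear_combination -(N₁ - 1) * hw + (N₁ - 1) * hwN₁ + eN₁sq - e2N₁
    have q3 : (N₁ - 1) * w * t = 1 := by rw [htN, q5]
    have q4 : (N₁ - 1) * w * r' = -2 := by rw [hr'N]; linear_combination 2 * (N₁ - 1) * hw + e2N₁
    refine Or.inr ⟨(N₁ - 1) * w, hu, Or.inr (Or.inl (Or.inr ⟨?_, ?_⟩))⟩
    · rw [q1, q2, q3]; exact triple_swap_right _ _ _
    · rw [q4, q5, q3]

/-- **THE MIXED CONFIGURATION `s′ = N₁ − s`.**  Let `τ = (r, s, t)`, `τ′ = (r′, s′, t′)` with `s, t, s′, t′` odd, sums `0`,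
`H_{τ′} = H_τ` (`n ≥ 4`) and `s′ = N₁ − s`.  The parity identity at `x = t`, `t + N₁` gives `t′ = t` or `t′ = N₁ − t`.  If `t′ = N₁ − t`
then `τ′ = (N₁ − 1)τ` (`r′ = −r`), and the identity at `x = s` forces either `r = N₁` (then `τ′` is a permutation of `τ`) or `s = t`,
`τ = s(N−2, 1, 1)`, `τ′ = s(2, N₁−1, N₁−1)` (list (2)).  If `t′ = t`, the identity at `x = s` reads `[2^{v(r)}(−s) = r] + … =
… + [2^{v(r′)}s = r′]`, so `r` is counted at `−s` (previous theorem) or `r′` at `s` (the previous theorem for `(τ′, τ)`): lists (1)–(2).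
So: EITHER `{τ′} = {τ}` OR, for a unit `w`, `(wτ, wτ′)` or `(wτ′, wτ)` is one of `((N−4,1,3), (N₁−2,N₁−1,3))`, `((N−2,1,1), (N₁,1,N₁−1))`,
`((N−2,1,1), (2,N₁−1,N₁−1))` up to permutations within the triples. [cite: KoblitzRohrlich1978, §5 Proposition, lists (1)–(2) (p. 1200)] -/
theorem mixed_of_units (hn : 4 ≤ n) {r s t r' s' t' : ZMod (2 ^ n)}
    (hr : r ≠ 0) (hs : IsUnit s) (ht : IsUnit t) (hrst : r + s + t = 0)
    (hr' : r' ≠ 0) (ht' : IsUnit t') (hrst' : r' + s' + t' = 0) (hs' : s' = -s + (2 : ZMod (2 ^ n)) ^ (n - 1))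
    (heq : fermatCMType (2 ^ n) r' s' t' = fermatCMType (2 ^ n) r s t) :
    ({r', s', t'} : Multiset (ZMod (2 ^ n))) = {r, s, t} ∨
      ∃ w : ZMod (2 ^ n), IsUnit w ∧
        (((({w * r, w * s, w * t} : Multiset (ZMod (2 ^ n))) = {-4, 1, 3} ∧
              ({w * r', w * s', w * t'} : Multiset (ZMod (2 ^ n))) = {(2 : ZMod (2 ^ n)) ^ (n - 1) - 2, (2 : ZMod (2 ^ n)) ^ (n - 1) - 1, 3}) ∨
            (({w * r, w * s, w * t} : Multiset (ZMod (2 ^ n))) = {(2 : ZMod (2 ^ n)) ^ (n - 1) - 2, (2 : ZMod (2 ^ n)) ^ (n - 1) - 1, 3} ∧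
              ({w * r', w * s', w * t'} : Multiset (ZMod (2 ^ n))) = {-4, 1, 3})) ∨
          ((({w * r, w * s, w * t} : Multiset (ZMod (2 ^ n))) = {-2, 1, 1} ∧
              ({w * r', w * s', w * t'} : Multiset (ZMod (2 ^ n))) = {(2 : ZMod (2 ^ n)) ^ (n - 1), 1, (2 : ZMod (2 ^ n)) ^ (n - 1) - 1}) ∨
            (({w * r, w * s, w * t} : Multiset (ZMod (2 ^ n))) = {(2 : ZMod (2 ^ n)) ^ (n - 1), 1, (2 : ZMod (2 ^ n)) ^ (n - 1) - 1} ∧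
              ({w * r', w * s', w * t'} : Multiset (ZMod (2 ^ n))) = {-2, 1, 1})) ∨
          ((({w * r, w * s, w * t} : Multiset (ZMod (2 ^ n))) = {-2, 1, 1} ∧
              ({w * r', w * s', w * t'} : Multiset (ZMod (2 ^ n))) = {2, (2 : ZMod (2 ^ n)) ^ (n - 1) - 1, (2 : ZMod (2 ^ n)) ^ (n - 1) - 1}) ∨
            (({w * r, w * s, w * t} : Multiset (ZMod (2 ^ n))) = {2, (2 : ZMod (2 ^ n)) ^ (n - 1) - 1, (2 : ZMod (2 ^ n)) ^ (n - 1) - 1} ∧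
              ({w * r', w * s', w * t'} : Multiset (ZMod (2 ^ n))) = {-2, 1, 1}))) := by
  classical
  subst hs'
  have hn0 : n ≠ 0 := by omega
  have hn2 : 2 ≤ n := by omega
  haveI : Fact (1 < 2 ^ n) := ⟨Nat.one_lt_pow hn0 (by norm_num)⟩
  set N₁ : ZMod (2 ^ n) := (2 : ZMod (2 ^ n)) ^ (n - 1) with hN₁
  set N₂ : ZMod (2 ^ n) := (2 : ZMod (2 ^ n)) ^ (n - 2) with hN₂
  set π₄ := ZMod.castHom (four_dvd_two_pow hn2) (ZMod 4) with hπ₄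
  have hπ₁ : π₄ N₁ = 0 := castHom_four_two_pow hn2 (by omega)
  have hπ₂ : π₄ N₂ = 0 := castHom_four_two_pow hn2 (by omega)
  have hXs : ∀ E : ZMod (2 ^ n), π₄ E = 0 → 2 * s = E → False := fun E hE h => two_mul_ne_of_castHom_four hn2 hs hE h
  have hXt : ∀ E : ZMod (2 ^ n), π₄ E = 0 → 2 * t = E → False := fun E hE h => two_mul_ne_of_castHom_four hn2 ht hE h
  have e2N₁ : 2 * N₁ = 0 := two_mul_pow_pred hn0
  have e2N₂ : 2 * N₂ = N₁ := two_mul_pow_pred_pred hn2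
  have hN₁0 : N₁ ≠ 0 := two_pow_ne_zero_of_lt (by omega)
  have hN₂0 : N₂ ≠ 0 := two_pow_ne_zero_of_lt (by omega)
  have hN₂1 : N₂ ≠ N₁ := fun h => hN₂0 (by linear_combination e2N₂ - h)
  have h2s : ZMod.castHom (dvd_pow_self 2 hn0) (ZMod 2) s = 1 := (isUnit_iff_castHom_two_eq_one hn0 s).1 hs
  have h2t : ZMod.castHom (dvd_pow_self 2 hn0) (ZMod 2) t = 1 := (isUnit_iff_castHom_two_eq_one hn0 t).1 ht
  have h2N₁ : ZMod.castHom (dvd_pow_self 2 hn0) (ZMod 2) N₁ = 0 := castHom_two_two_pow hn0 (by omega)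
  have h2N₂ : ZMod.castHom (dvd_pow_self 2 hn0) (ZMod 2) N₂ = 0 := castHom_two_two_pow hn0 (by omega)
  have hs'u : IsUnit (-s + N₁) := isUnit_of_castHom_two_eq_one hn0 (by rw [map_add, map_neg, h2s, h2N₁, add_zero]; decide)
  have htN : IsUnit (t + N₁) := isUnit_of_castHom_two_eq_one hn0 (by rw [map_add, h2t, h2N₁, add_zero])
  have hru : ¬IsUnit r := not_isUnit_of_add_units hn0 hs ht hrst
  have hr'u : ¬IsUnit r' := not_isUnit_of_add_units hn0 hs'u ht' hrst'
  have hdN : ∀ {e : ZMod (2 ^ n)}, e ≠ 0 → ¬IsUnit e → (2 : ZMod (2 ^ n)) ^ (e.val.factorization 2) * N₁ = 0 :=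
    fun he heu => two_pow_factorization_mul_pow_pred he heu
  obtain ⟨w, hw⟩ := hs.exists_left_inv
  have hwu : IsUnit w := IsUnit.of_mul_eq_one s hw
  have hwN₁ : w * N₁ = N₁ := by rw [mul_comm]; exact pow_pred_mul_eq_of_isUnit_twoPow hn0 hwu
  -- Step 1: the identity at `x = t`, `x = t + N₁` gives `t′ = t` or `t′ = N₁ − t`
  have hsplit : t = t' ∨ -(t + N₁) = t' := by
    have i1 : (-t = -s + N₁) ↔ (t + N₁ = s) := by constructor <;> intro h <;> linear_combination -h
    have i2 : (-(t + N₁) = -s + N₁) ↔ (t = s) := by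
      constructor <;> intro h <;> linear_combination -h - e2N₁
    have i3 : (-(t + N₁) = s) ↔ (t = -s + N₁) := by
      constructor <;> intro h <;> linear_combination -h - e2N₁
    have f1 : ¬(-t = s) := fun h => hr (by linear_combination hrst + h)
    have f2 : ¬(-t = t) := fun h => hXt 0 (map_zero _) (by linear_combination -h)
    have f3 : ¬(t + N₁ = t) := fun h => hN₁0 (by linear_combination h)
    have f4 : ¬(-(t + N₁) = t) := fun h => hXt (-N₁) (by simp [hπ₁]) (by linear_combination -h)
    have f5 : ¬(t + N₁ = -s + N₁) := fun h => hr (by linear_combination hrst - h)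
    have h1 := countP_add_countP_eq_of_fermatCMType_eq (p := 2) hn0 hr hs.ne_zero ht.ne_zero hrst hr' hs'u.ne_zero
      ht'.ne_zero hrst' heq ht
    have h2 := countP_add_countP_eq_of_fermatCMType_eq (p := 2) hn0 hr hs.ne_zero ht.ne_zero hrst hr' hs'u.ne_zero
      ht'.ne_zero hrst' heq htN
    simp only [Multiset.insert_eq_cons, ← Multiset.cons_zero, Multiset.countP_cons, Multiset.countP_zero, zero_add,
      Nat.cast_ofNat, fibre_iff_of_isUnit hn0 hs, fibre_iff_of_isUnit hn0 ht, fibre_iff_of_isUnit hn0 hs'u,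
      fibre_iff_of_isUnit hn0 ht', fibre_add_iff (hdN hr hru), fibre_neg_add_iff (hdN hr hru), fibre_add_iff (hdN hr' hr'u),
      fibre_neg_add_iff (hdN hr' hr'u), i1, i2, i3, f1, f2, f3, f4, f5, if_true, if_false, add_zero, zero_add] at h1 h2
    have b1 : (if -t = t' then 1 else 0 : ℕ) ≤ 1 := by split_ifs <;> omega
    have b2 : (if t + N₁ = t' then 1 else 0 : ℕ) ≤ 1 := by split_ifs <;> omega
    by_contra hnot
    obtain ⟨hC, hD⟩ := not_or.1 hnot
    rw [if_neg hC] at h1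
    rw [if_neg hD] at h2
    omega
  rcases hsplit with hC | hD
  · -- Step 3 (`t′ = t`): `r` counted at `−s`, or `r′` counted at `s`
    subst hC
    by_cases hI : (2 : ZMod (2 ^ n)) ^ (r.val.factorization 2) * -s = r
    · exact mixed_of_fibre_neg hn hr hs ht hrst hr' hrst' heq hI
    · have hII : (2 : ZMod (2 ^ n)) ^ (r'.val.factorization 2) * s = r' := by
        have f1 : ¬(-s = -s + N₁) := fun h => hN₁0 (by linear_combination -h)
        have f2 : ¬(-s = t) := fun h => hr (by linear_combination hrst + h)
        have f3 : ¬(-s = s) := fun h => hXs 0 (map_zero _) (by linear_combination -h)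
        have f4 : ¬(s = -s + N₁) := fun h => hXs N₁ (by simp [hπ₁]) (by linear_combination h)
        have h := countP_add_countP_eq_of_fermatCMType_eq (p := 2) hn0 hr hs.ne_zero ht.ne_zero hrst hr' hs'u.ne_zero
          ht.ne_zero hrst' heq hs
        simp only [Multiset.insert_eq_cons, ← Multiset.cons_zero, Multiset.countP_cons, Multiset.countP_zero, zero_add,
          Nat.cast_ofNat, fibre_iff_of_isUnit hn0 hs, fibre_iff_of_isUnit hn0 ht, fibre_iff_of_isUnit hn0 hs'u,
          f1, f2, f3, f4, hI, if_true, if_false, add_zero, zero_add] at h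
        have b1 : (if s = t then 1 else 0 : ℕ) ≤ 1 := by split_ifs <;> omega
        by_contra hII
        rw [if_neg hII] at h
        omega
      -- the mirror image: `(τ′, τ)` is a mixed configuration with `r′` counted at `−s′`
      have es : -(-s + N₁) + N₁ = s := by ring
      have hrst₂ : r + (-(-s + N₁) + N₁) + t = 0 := by rw [es]; exact hrst
      have heq₂ : fermatCMType (2 ^ n) r (-(-s + N₁) + N₁) t = fermatCMType (2 ^ n) r' (-s + N₁) t := by
        rw [es]; exact heq.symm
      have hF₂ : (2 : ZMod (2 ^ n)) ^ (r'.val.factorization 2) * -(-s + N₁) = r' := by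
        rw [neg_add, neg_neg, mul_add, hII, mul_neg, hdN hr' hr'u, neg_zero, add_zero]
      have hres := mixed_of_fibre_neg hn hr' hs'u ht hrst' hr hrst₂ heq₂ hF₂
      simp only [← hN₁, es] at hres
      rcases hres with hperm | ⟨w', hw', h⟩
      · exact Or.inl hperm.symm
      · refine Or.inr ⟨w', hw', ?_⟩
        rcases h with (⟨h₁, h₂⟩ | ⟨h₁, h₂⟩) | (⟨h₁, h₂⟩ | ⟨h₁, h₂⟩) | (⟨h₁, h₂⟩ | ⟨h₁, h₂⟩)
        · exact Or.inl (Or.inr ⟨h₂, h₁⟩)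
        · exact Or.inl (Or.inl ⟨h₂, h₁⟩)
        · exact Or.inr (Or.inl (Or.inr ⟨h₂, h₁⟩))
        · exact Or.inr (Or.inl (Or.inl ⟨h₂, h₁⟩))
        · exact Or.inr (Or.inr (Or.inr ⟨h₂, h₁⟩))
        · exact Or.inr (Or.inr (Or.inl ⟨h₂, h₁⟩))
  · -- Step 2 (`t′ = N₁ − t`): `r′ = −r`
    have ht'v : t' = -(t + N₁) := hD.symm
    subst ht'v
    have hr'r : r' = -r := by linear_combination hrst' + hrst
    subst hr'r
    by_cases hQ : r = N₁
    · -- `r = N₁`: `τ′` is a permutation of `τ`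
      left
      have htv : t = -s + N₁ := by linear_combination hrst - hQ - e2N₁
      rw [show -r = r by rw [hQ]; linear_combination -e2N₁, show -(t + N₁) = s by rw [htv]; linear_combination -e2N₁, ← htv]
      exact triple_swap_right _ _ _
    by_cases hA : s = t
    · -- `s = t`: list (2), `(N−2, 1, 1)` with `(2, N₁−1, N₁−1)`
      subst hA
      have hr2 : r = -(2 * s) := by linear_combination hrst
      have p1 : w * r = -2 := by rw [hr2]; linear_combination -2 * hw
      have p4 : w * -r = 2 := by rw [hr2]; linear_combination 2 * hw
      have p5 : w * (-s + N₁) = N₁ - 1 := by linear_combination -hw + hwN₁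
      have p6 : w * -(s + N₁) = N₁ - 1 := by linear_combination -hw - hwN₁ - e2N₁
      refine Or.inr ⟨w, hwu, Or.inr (Or.inr (Or.inl ⟨?_, ?_⟩))⟩
      · rw [p1, hw]
      · rw [p4, p5, p6]
    · -- otherwise the identity at `x = s` is contradictory
      exfalso
      have i4 : (-s = -(t + N₁)) ↔ (t + N₁ = s) := by constructor <;> intro h <;> linear_combination h
      have f1 : ¬(-s = -s + N₁) := fun h => hN₁0 (by linear_combination -h)
      have f2 : ¬(-s = s) := fun h => hXs 0 (map_zero _) (by linear_combination -h)
      have f3 : ¬(-s = t) := fun h => hr (by linear_combination hrst + h)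
      have f4 : ¬(s = -s + N₁) := fun h => hXs N₁ (by simp [hπ₁]) (by linear_combination h)
      have f5 : ¬(s = -(t + N₁)) := fun h => hQ (by linear_combination hrst - h)
      have hrn : -r ≠ 0 := neg_ne_zero.2 hr
      have h := countP_add_countP_eq_of_fermatCMType_eq (p := 2) hn0 hr hs.ne_zero ht.ne_zero hrst hrn hs'u.ne_zero
        htN.neg.ne_zero (by linear_combination -hrst) heq hs
      by_cases hP : t + N₁ = s
      · -- `t = s + N₁`: `r = 2(−s + N₂)` is never counted at `±s`
        have hc₁ : IsUnit (-s + N₂) := isUnit_of_castHom_two_eq_one hn0 (by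
          rw [map_add, map_neg, h2s, h2N₂, add_zero]; decide)
        have hr2 : r = 2 * (-s + N₂) := by linear_combination hrst - hP - e2N₂
        have g1 : ¬(s = -s + N₂) := fun h => hXs N₂ (by simp [hπ₂]) (by linear_combination h)
        have g2 : ¬(s = -s + N₂ + N₁) := fun h => hXs (N₂ + N₁) (by simp [hπ₁, hπ₂]) (by linear_combination h)
        have g3 : ¬(-s = -s + N₂) := fun h => hN₂0 (by linear_combination -h)
        have g4 : ¬(-s = -s + N₂ + N₁) := fun h => hN₂1 (by linear_combination -h - e2N₁)
        simp only [Multiset.insert_eq_cons, ← Multiset.cons_zero, Multiset.countP_cons, Multiset.countP_zero, zero_add,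
          Nat.cast_ofNat, fibre_iff_of_isUnit hn0 hs, fibre_iff_of_isUnit hn0 ht, fibre_iff_of_isUnit hn0 hs'u,
          fibre_neg_iff, neg_neg, fibre_iff_of_eq_two_mul hn2 hc₁ hr2, ← hN₁, hP,
          f1, f2, f3, f4, hA, g1, g2, g3, g4, or_self, if_true, if_false, add_zero, zero_add] at h
        omega
      · have hFF : (if (2 : ZMod (2 ^ n)) ^ (r.val.factorization 2) * s = r then 1 else 0 : ℕ) +
            (if (2 : ZMod (2 ^ n)) ^ (r.val.factorization 2) * -s = r then 1 else 0 : ℕ) ≤ 1 := by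
          split_ifs with h₁ h₂
          · exact absurd (eq_pow_pred_of_fibre_of_fibre_neg hn0 hr hs h₁ h₂) hQ
          all_goals omega
        simp only [Multiset.insert_eq_cons, ← Multiset.cons_zero, Multiset.countP_cons, Multiset.countP_zero, zero_add,
          Nat.cast_ofNat, fibre_iff_of_isUnit hn0 hs, fibre_iff_of_isUnit hn0 ht, fibre_iff_of_isUnit hn0 hs'u,
          fibre_iff_of_isUnit hn0 htN.neg, fibre_neg_iff, neg_neg, i4, hP, f1, f2, f3, f4, f5, hA, if_true, if_false,
          add_zero, zero_add] at h
        omega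

/-- **Both triples of the shape `(·, s, s + N₁)`.**  Let `τ = (r, s, s + N₁)`, `τ′ = (r′, s′, s′ + N₁)` (`s, s′` odd, sums `0`,
`H_{τ′} = H_τ`, `n ≥ 4`), i.e. `τ = s·(N₁−2, 1, N₁+1)`, `τ′ = s′·(N₁−2, 1, N₁+1)`.  The parity identity at `x = s′` gives
`s′ ∈ {s, s + N₁}` (`τ′` is a permutation of `τ`) or `s′ ∈ {−s − N₂, −s + N₂}`, in which case `τ′ = s·(2, N₂−1, 3N₂−1)` up to order:
the pair `((N₁−2, 1, N₁+1), (2, N₂−1, 3N₂−1))` of list (3) — equivalently, the stabiliser of `H_{(N₁−2,1,N₁+1)}` is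
`{1, 1+N₁, N₂−1, 3N₂−1}`. [cite: KoblitzRohrlich1978, §5 Proposition, list (3) (p. 1200)] -/
theorem exceptional_of_add_pow_pred (hn : 4 ≤ n) {r s r' s' : ZMod (2 ^ n)} (hr : r ≠ 0) (hs : IsUnit s)
    (hrst : r + s + (s + (2 : ZMod (2 ^ n)) ^ (n - 1)) = 0) (hr' : r' ≠ 0) (hs' : IsUnit s')
    (hrst' : r' + s' + (s' + (2 : ZMod (2 ^ n)) ^ (n - 1)) = 0)
    (heq : fermatCMType (2 ^ n) r' s' (s' + (2 : ZMod (2 ^ n)) ^ (n - 1)) =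
      fermatCMType (2 ^ n) r s (s + (2 : ZMod (2 ^ n)) ^ (n - 1))) :
    ({r', s', s' + (2 : ZMod (2 ^ n)) ^ (n - 1)} : Multiset (ZMod (2 ^ n))) = {r, s, s + (2 : ZMod (2 ^ n)) ^ (n - 1)} ∨
      ∃ w : ZMod (2 ^ n), IsUnit w ∧
        ({w * r, w * s, w * (s + (2 : ZMod (2 ^ n)) ^ (n - 1))} : Multiset (ZMod (2 ^ n))) =
            {(2 : ZMod (2 ^ n)) ^ (n - 1) - 2, 1, (2 : ZMod (2 ^ n)) ^ (n - 1) + 1} ∧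
          ({w * r', w * s', w * (s' + (2 : ZMod (2 ^ n)) ^ (n - 1))} : Multiset (ZMod (2 ^ n))) =
            {2, (2 : ZMod (2 ^ n)) ^ (n - 2) - 1, 3 * (2 : ZMod (2 ^ n)) ^ (n - 2) - 1} := by
  classical
  have hn0 : n ≠ 0 := by omega
  have hn2 : 2 ≤ n := by omega
  haveI : Fact (1 < 2 ^ n) := ⟨Nat.one_lt_pow hn0 (by norm_num)⟩
  set N₁ : ZMod (2 ^ n) := (2 : ZMod (2 ^ n)) ^ (n - 1) with hN₁
  set N₂ : ZMod (2 ^ n) := (2 : ZMod (2 ^ n)) ^ (n - 2) with hN₂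
  set π₄ := ZMod.castHom (four_dvd_two_pow hn2) (ZMod 4) with hπ₄
  have hπ₁ : π₄ N₁ = 0 := castHom_four_two_pow hn2 (by omega)
  have hπ₂ : π₄ N₂ = 0 := castHom_four_two_pow hn2 (by omega)
  have hX : ∀ E : ZMod (2 ^ n), π₄ E = 0 → 2 * s' = E → False := fun E hE h => two_mul_ne_of_castHom_four hn2 hs' hE h
  have e2N₁ : 2 * N₁ = 0 := two_mul_pow_pred hn0
  have e2N₂ : 2 * N₂ = N₁ := two_mul_pow_pred_pred hn2
  have hN₁0 : N₁ ≠ 0 := two_pow_ne_zero_of_lt (by omega)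
  have hN₂0 : N₂ ≠ 0 := two_pow_ne_zero_of_lt (by omega)
  have hN₂1 : N₂ ≠ N₁ := fun h => hN₂0 (by linear_combination e2N₂ - h)
  have h2s : ZMod.castHom (dvd_pow_self 2 hn0) (ZMod 2) s = 1 := (isUnit_iff_castHom_two_eq_one hn0 s).1 hs
  have h2s' : ZMod.castHom (dvd_pow_self 2 hn0) (ZMod 2) s' = 1 := (isUnit_iff_castHom_two_eq_one hn0 s').1 hs'
  have h2N₁ : ZMod.castHom (dvd_pow_self 2 hn0) (ZMod 2) N₁ = 0 := castHom_two_two_pow hn0 (by omega)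
  have h2N₂ : ZMod.castHom (dvd_pow_self 2 hn0) (ZMod 2) N₂ = 0 := castHom_two_two_pow hn0 (by omega)
  have hsN : IsUnit (s + N₁) := isUnit_of_castHom_two_eq_one hn0 (by rw [map_add, h2s, h2N₁, add_zero])
  have hs'N : IsUnit (s' + N₁) := isUnit_of_castHom_two_eq_one hn0 (by rw [map_add, h2s', h2N₁, add_zero])
  have hc₀ : IsUnit (-s - N₂) := isUnit_of_castHom_two_eq_one hn0 (by rw [map_sub, map_neg, h2s, h2N₂, sub_zero]; decide)
  have hc₀' : IsUnit (-s' - N₂) := isUnit_of_castHom_two_eq_one hn0 (by rw [map_sub, map_neg, h2s', h2N₂, sub_zero]; decide)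
  have hr2 : r = 2 * (-s - N₂) := by linear_combination hrst + e2N₂
  have hr2' : r' = 2 * (-s' - N₂) := by linear_combination hrst' + e2N₂
  -- the identity at `x = s′`
  have g1 : ¬(-s' = -s' - N₂) := fun h => hN₂0 (by linear_combination h)
  have g2 : ¬(-s' = -s' - N₂ + N₁) := fun h => hN₂1 (by linear_combination h)
  have g3 : ¬(-s' = s') := fun h => hX 0 (map_zero _) (by linear_combination -h)
  have g4 : ¬(-s' = s' + N₁) := fun h => hX (-N₁) (by simp [hπ₁]) (by linear_combination -h)
  have g5 : ¬(s' = -s' - N₂) := fun h => hX (-N₂) (by simp [hπ₂]) (by linear_combination h)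
  have g6 : ¬(s' = -s' - N₂ + N₁) := fun h => hX (-N₂ + N₁) (by simp [hπ₁, hπ₂]) (by linear_combination h)
  have g7 : ¬(s' = s' + N₁) := fun h => hN₁0 (by linear_combination -h)
  have h := countP_add_countP_eq_of_fermatCMType_eq (p := 2) hn0 hr hs.ne_zero hsN.ne_zero hrst hr' hs'.ne_zero
    hs'N.ne_zero hrst' heq hs'
  simp only [Multiset.insert_eq_cons, ← Multiset.cons_zero, Multiset.countP_cons, Multiset.countP_zero, zero_add,
    Nat.cast_ofNat, fibre_iff_of_isUnit hn0 hs, fibre_iff_of_isUnit hn0 hsN, fibre_iff_of_isUnit hn0 hs',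
    fibre_iff_of_isUnit hn0 hs'N, fibre_iff_of_eq_two_mul hn2 hc₀ hr2, fibre_iff_of_eq_two_mul hn2 hc₀' hr2', ← hN₁,
    g1, g2, g3, g4, g5, g6, g7, or_self, if_true, if_false, add_zero, zero_add] at h
  have hcases : (s' = -s - N₂ ∨ s' = -s - N₂ + N₁) ∨ s' = s ∨ s' = s + N₁ := by
    by_contra hnot
    simp only [not_or] at hnot
    obtain ⟨⟨hL₁, hL₁'⟩, hL₂, hL₃⟩ := hnot
    simp only [hL₁, hL₁', hL₂, hL₃, or_self, if_false, add_zero] at h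
    omega
  rcases hcases with hL₁ | hL₂ | hL₃
  · -- `s′ ∈ {−s − N₂, −s + N₂}`: the pair of list (3)
    right
    obtain ⟨w, hw⟩ := hs.exists_left_inv
    have hwu : IsUnit w := IsUnit.of_mul_eq_one s hw
    have hwN₁ : w * N₁ = N₁ := by rw [mul_comm]; exact pow_pred_mul_eq_of_isUnit_twoPow hn0 hwu
    have e4N₂ : 4 * N₂ = 0 := by linear_combination 2 * e2N₂ + e2N₁
    refine ⟨w, hwu, ?_, ?_⟩
    · rw [show w * r = N₁ - 2 by rw [hr2]; linear_combination -2 * hw - w * e2N₂ - hwN₁ - e2N₁, hw,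
        show w * (s + N₁) = N₁ + 1 by linear_combination hw + hwN₁]
    · have p4 : w * r' = 2 := by
        rw [hr2']
        rcases hL₁ with h₁ | h₁ <;> rw [h₁]
        · linear_combination 2 * hw
        · linear_combination 2 * hw - 2 * hwN₁ - e2N₁
      rw [p4]
      rcases hL₁ with h₁ | h₁ <;> rcases pow_pred_pred_mul_of_isUnit hn2 hwu with h₂ | h₂ <;> rw [mul_comm] at h₂ <;> rw [h₁]
      · rw [show w * (-s - N₂) = 3 * N₂ - 1 by linear_combination -hw - h₂ - e4N₂,
          show w * (-s - N₂ + N₁) = N₂ - 1 by linear_combination -hw - h₂ + hwN₁ - e2N₂]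
        exact triple_swap_right _ _ _
      · rw [show w * (-s - N₂) = N₂ - 1 by linear_combination -hw - h₂ - e2N₂ - e2N₁,
          show w * (-s - N₂ + N₁) = 3 * N₂ - 1 by linear_combination -hw - h₂ + hwN₁ - e4N₂]
      · rw [show w * (-s - N₂ + N₁) = N₂ - 1 by linear_combination -hw - h₂ + hwN₁ - e2N₂,
          show w * (-s - N₂ + N₁ + N₁) = 3 * N₂ - 1 by linear_combination -hw - h₂ + 2 * hwN₁ - e4N₂ + e2N₁]
      · rw [show w * (-s - N₂ + N₁) = 3 * N₂ - 1 by linear_combination -hw - h₂ + hwN₁ - e4N₂,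
          show w * (-s - N₂ + N₁ + N₁) = N₂ - 1 by linear_combination -hw - h₂ + 2 * hwN₁ - e2N₂]
        exact triple_swap_right _ _ _
  · -- `s′ = s`
    left
    subst hL₂
    rw [show r' = r by linear_combination hrst' - hrst]
  · -- `s′ = s + N₁`
    left
    subst hL₃
    rw [show r' = r by linear_combination hrst' - hrst - e2N₁, show s + N₁ + N₁ = s by linear_combination e2N₁]
    exact triple_swap_right _ _ _

end OddOdd

/-! ## §5 The seven exceptional pairs (K–R's lists (1)–(3)) and the bookkeeping of the classification -/

section Kernel

variable {n : ℕ}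

/-- The seven exceptional pairs, read in either order, are a symmetric relation. [cite: KoblitzRohrlich1978, §5 Proposition (p. 1200)] -/
theorem kernel_symm {M M' : Multiset (ZMod (2 ^ n))}
    (h : ((M = {-4, 1, 3} ∧
          M' = {(2 : ZMod (2 ^ n)) ^ (n - 1) - 2, (2 : ZMod (2 ^ n)) ^ (n - 1) - 1, 3}) ∨
        (M = {(2 : ZMod (2 ^ n)) ^ (n - 1) - 2, (2 : ZMod (2 ^ n)) ^ (n - 1) - 1, 3} ∧
          M' = {-4, 1, 3})) ∨
      ((M = {-2, 1, 1} ∧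
          M' = {(2 : ZMod (2 ^ n)) ^ (n - 1), 1, (2 : ZMod (2 ^ n)) ^ (n - 1) - 1}) ∨
        (M = {(2 : ZMod (2 ^ n)) ^ (n - 1), 1, (2 : ZMod (2 ^ n)) ^ (n - 1) - 1} ∧
          M' = {-2, 1, 1})) ∨
      ((M = {-2, 1, 1} ∧
          M' = {2, (2 : ZMod (2 ^ n)) ^ (n - 1) - 1, (2 : ZMod (2 ^ n)) ^ (n - 1) - 1}) ∨
        (M = {2, (2 : ZMod (2 ^ n)) ^ (n - 1) - 1, (2 : ZMod (2 ^ n)) ^ (n - 1) - 1} ∧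
          M' = {-2, 1, 1})) ∨
      ((M = {(2 : ZMod (2 ^ n)) ^ (n - 1) - 2, 1, (2 : ZMod (2 ^ n)) ^ (n - 1) + 1} ∧
          M' = {-4, 2, 2}) ∨
        (M = {-4, 2, 2} ∧
          M' = {(2 : ZMod (2 ^ n)) ^ (n - 1) - 2, 1, (2 : ZMod (2 ^ n)) ^ (n - 1) + 1})) ∨
      ((M = {(2 : ZMod (2 ^ n)) ^ (n - 1) - 2, 1, (2 : ZMod (2 ^ n)) ^ (n - 1) + 1} ∧
          M' = {2, (2 : ZMod (2 ^ n)) ^ (n - 2) - 1, 3 * (2 : ZMod (2 ^ n)) ^ (n - 2) - 1}) ∨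
        (M = {2, (2 : ZMod (2 ^ n)) ^ (n - 2) - 1, 3 * (2 : ZMod (2 ^ n)) ^ (n - 2) - 1} ∧
          M' = {(2 : ZMod (2 ^ n)) ^ (n - 1) - 2, 1, (2 : ZMod (2 ^ n)) ^ (n - 1) + 1})) ∨
      ((M = {(2 : ZMod (2 ^ n)) ^ (n - 1) - 2, 1, (2 : ZMod (2 ^ n)) ^ (n - 1) + 1} ∧
          M' = {(2 : ZMod (2 ^ n)) ^ (n - 1), 2, (2 : ZMod (2 ^ n)) ^ (n - 1) - 2}) ∨
        (M = {(2 : ZMod (2 ^ n)) ^ (n - 1), 2, (2 : ZMod (2 ^ n)) ^ (n - 1) - 2} ∧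
          M' = {(2 : ZMod (2 ^ n)) ^ (n - 1) - 2, 1, (2 : ZMod (2 ^ n)) ^ (n - 1) + 1})) ∨
      ((M = {2, (2 : ZMod (2 ^ n)) ^ (n - 2) - 1, 3 * (2 : ZMod (2 ^ n)) ^ (n - 2) - 1} ∧
          M' = {-4, 2, 2}) ∨
        (M = {-4, 2, 2} ∧
          M' = {2, (2 : ZMod (2 ^ n)) ^ (n - 2) - 1, 3 * (2 : ZMod (2 ^ n)) ^ (n - 2) - 1}))) :
    ((M' = {-4, 1, 3} ∧
          M = {(2 : ZMod (2 ^ n)) ^ (n - 1) - 2, (2 : ZMod (2 ^ n)) ^ (n - 1) - 1, 3}) ∨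
        (M' = {(2 : ZMod (2 ^ n)) ^ (n - 1) - 2, (2 : ZMod (2 ^ n)) ^ (n - 1) - 1, 3} ∧
          M = {-4, 1, 3})) ∨
      ((M' = {-2, 1, 1} ∧
          M = {(2 : ZMod (2 ^ n)) ^ (n - 1), 1, (2 : ZMod (2 ^ n)) ^ (n - 1) - 1}) ∨
        (M' = {(2 : ZMod (2 ^ n)) ^ (n - 1), 1, (2 : ZMod (2 ^ n)) ^ (n - 1) - 1} ∧
          M = {-2, 1, 1})) ∨
      ((M' = {-2, 1, 1} ∧
          M = {2, (2 : ZMod (2 ^ n)) ^ (n - 1) - 1, (2 : ZMod (2 ^ n)) ^ (n - 1) - 1}) ∨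
        (M' = {2, (2 : ZMod (2 ^ n)) ^ (n - 1) - 1, (2 : ZMod (2 ^ n)) ^ (n - 1) - 1} ∧
          M = {-2, 1, 1})) ∨
      ((M' = {(2 : ZMod (2 ^ n)) ^ (n - 1) - 2, 1, (2 : ZMod (2 ^ n)) ^ (n - 1) + 1} ∧
          M = {-4, 2, 2}) ∨
        (M' = {-4, 2, 2} ∧
          M = {(2 : ZMod (2 ^ n)) ^ (n - 1) - 2, 1, (2 : ZMod (2 ^ n)) ^ (n - 1) + 1})) ∨
      ((M' = {(2 : ZMod (2 ^ n)) ^ (n - 1) - 2, 1, (2 : ZMod (2 ^ n)) ^ (n - 1) + 1} ∧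
          M = {2, (2 : ZMod (2 ^ n)) ^ (n - 2) - 1, 3 * (2 : ZMod (2 ^ n)) ^ (n - 2) - 1}) ∨
        (M' = {2, (2 : ZMod (2 ^ n)) ^ (n - 2) - 1, 3 * (2 : ZMod (2 ^ n)) ^ (n - 2) - 1} ∧
          M = {(2 : ZMod (2 ^ n)) ^ (n - 1) - 2, 1, (2 : ZMod (2 ^ n)) ^ (n - 1) + 1})) ∨
      ((M' = {(2 : ZMod (2 ^ n)) ^ (n - 1) - 2, 1, (2 : ZMod (2 ^ n)) ^ (n - 1) + 1} ∧
          M = {(2 : ZMod (2 ^ n)) ^ (n - 1), 2, (2 : ZMod (2 ^ n)) ^ (n - 1) - 2}) ∨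
        (M' = {(2 : ZMod (2 ^ n)) ^ (n - 1), 2, (2 : ZMod (2 ^ n)) ^ (n - 1) - 2} ∧
          M = {(2 : ZMod (2 ^ n)) ^ (n - 1) - 2, 1, (2 : ZMod (2 ^ n)) ^ (n - 1) + 1})) ∨
      ((M' = {2, (2 : ZMod (2 ^ n)) ^ (n - 2) - 1, 3 * (2 : ZMod (2 ^ n)) ^ (n - 2) - 1} ∧
          M = {-4, 2, 2}) ∨
        (M' = {-4, 2, 2} ∧
          M = {2, (2 : ZMod (2 ^ n)) ^ (n - 2) - 1, 3 * (2 : ZMod (2 ^ n)) ^ (n - 2) - 1})) := by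
  rcases h with h | h | h | h | h | h | h
  · rcases h with ⟨h₁, h₂⟩ | ⟨h₁, h₂⟩
    · exact Or.inl (Or.inr ⟨h₂, h₁⟩)
    · exact Or.inl (Or.inl ⟨h₂, h₁⟩)
  · rcases h with ⟨h₁, h₂⟩ | ⟨h₁, h₂⟩
    · exact Or.inr (Or.inl (Or.inr ⟨h₂, h₁⟩))
    · exact Or.inr (Or.inl (Or.inl ⟨h₂, h₁⟩))
  · rcases h with ⟨h₁, h₂⟩ | ⟨h₁, h₂⟩
    · exact Or.inr (Or.inr (Or.inl (Or.inr ⟨h₂, h₁⟩)))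
    · exact Or.inr (Or.inr (Or.inl (Or.inl ⟨h₂, h₁⟩)))
  · rcases h with ⟨h₁, h₂⟩ | ⟨h₁, h₂⟩
    · exact Or.inr (Or.inr (Or.inr (Or.inl (Or.inr ⟨h₂, h₁⟩))))
    · exact Or.inr (Or.inr (Or.inr (Or.inl (Or.inl ⟨h₂, h₁⟩))))
  · rcases h with ⟨h₁, h₂⟩ | ⟨h₁, h₂⟩
    · exact Or.inr (Or.inr (Or.inr (Or.inr (Or.inl (Or.inr ⟨h₂, h₁⟩)))))
    · exact Or.inr (Or.inr (Or.inr (Or.inr (Or.inl (Or.inl ⟨h₂, h₁⟩)))))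
  · rcases h with ⟨h₁, h₂⟩ | ⟨h₁, h₂⟩
    · exact Or.inr (Or.inr (Or.inr (Or.inr (Or.inr (Or.inl (Or.inr ⟨h₂, h₁⟩))))))
    · exact Or.inr (Or.inr (Or.inr (Or.inr (Or.inr (Or.inl (Or.inl ⟨h₂, h₁⟩))))))
  · rcases h with ⟨h₁, h₂⟩ | ⟨h₁, h₂⟩
    · exact Or.inr (Or.inr (Or.inr (Or.inr (Or.inr (Or.inr (Or.inr ⟨h₂, h₁⟩))))))
    · exact Or.inr (Or.inr (Or.inr (Or.inr (Or.inr (Or.inr (Or.inl ⟨h₂, h₁⟩))))))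

/-- Lists (1)–(2) inside the seven pairs. [cite: KoblitzRohrlich1978, §5 Proposition (p. 1200)] -/
theorem kernel_of_mixed {M M' : Multiset (ZMod (2 ^ n))}
    (h : ((M = {-4, 1, 3} ∧
          M' = {(2 : ZMod (2 ^ n)) ^ (n - 1) - 2, (2 : ZMod (2 ^ n)) ^ (n - 1) - 1, 3}) ∨
        (M = {(2 : ZMod (2 ^ n)) ^ (n - 1) - 2, (2 : ZMod (2 ^ n)) ^ (n - 1) - 1, 3} ∧
          M' = {-4, 1, 3})) ∨
      ((M = {-2, 1, 1} ∧
          M' = {(2 : ZMod (2 ^ n)) ^ (n - 1), 1, (2 : ZMod (2 ^ n)) ^ (n - 1) - 1}) ∨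
        (M = {(2 : ZMod (2 ^ n)) ^ (n - 1), 1, (2 : ZMod (2 ^ n)) ^ (n - 1) - 1} ∧
          M' = {-2, 1, 1})) ∨
      ((M = {-2, 1, 1} ∧
          M' = {2, (2 : ZMod (2 ^ n)) ^ (n - 1) - 1, (2 : ZMod (2 ^ n)) ^ (n - 1) - 1}) ∨
        (M = {2, (2 : ZMod (2 ^ n)) ^ (n - 1) - 1, (2 : ZMod (2 ^ n)) ^ (n - 1) - 1} ∧
          M' = {-2, 1, 1}))) :
    ((M = {-4, 1, 3} ∧
          M' = {(2 : ZMod (2 ^ n)) ^ (n - 1) - 2, (2 : ZMod (2 ^ n)) ^ (n - 1) - 1, 3}) ∨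
        (M = {(2 : ZMod (2 ^ n)) ^ (n - 1) - 2, (2 : ZMod (2 ^ n)) ^ (n - 1) - 1, 3} ∧
          M' = {-4, 1, 3})) ∨
      ((M = {-2, 1, 1} ∧
          M' = {(2 : ZMod (2 ^ n)) ^ (n - 1), 1, (2 : ZMod (2 ^ n)) ^ (n - 1) - 1}) ∨
        (M = {(2 : ZMod (2 ^ n)) ^ (n - 1), 1, (2 : ZMod (2 ^ n)) ^ (n - 1) - 1} ∧
          M' = {-2, 1, 1})) ∨
      ((M = {-2, 1, 1} ∧
          M' = {2, (2 : ZMod (2 ^ n)) ^ (n - 1) - 1, (2 : ZMod (2 ^ n)) ^ (n - 1) - 1}) ∨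
        (M = {2, (2 : ZMod (2 ^ n)) ^ (n - 1) - 1, (2 : ZMod (2 ^ n)) ^ (n - 1) - 1} ∧
          M' = {-2, 1, 1})) ∨
      ((M = {(2 : ZMod (2 ^ n)) ^ (n - 1) - 2, 1, (2 : ZMod (2 ^ n)) ^ (n - 1) + 1} ∧
          M' = {-4, 2, 2}) ∨
        (M = {-4, 2, 2} ∧
          M' = {(2 : ZMod (2 ^ n)) ^ (n - 1) - 2, 1, (2 : ZMod (2 ^ n)) ^ (n - 1) + 1})) ∨
      ((M = {(2 : ZMod (2 ^ n)) ^ (n - 1) - 2, 1, (2 : ZMod (2 ^ n)) ^ (n - 1) + 1} ∧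
          M' = {2, (2 : ZMod (2 ^ n)) ^ (n - 2) - 1, 3 * (2 : ZMod (2 ^ n)) ^ (n - 2) - 1}) ∨
        (M = {2, (2 : ZMod (2 ^ n)) ^ (n - 2) - 1, 3 * (2 : ZMod (2 ^ n)) ^ (n - 2) - 1} ∧
          M' = {(2 : ZMod (2 ^ n)) ^ (n - 1) - 2, 1, (2 : ZMod (2 ^ n)) ^ (n - 1) + 1})) ∨
      ((M = {(2 : ZMod (2 ^ n)) ^ (n - 1) - 2, 1, (2 : ZMod (2 ^ n)) ^ (n - 1) + 1} ∧
          M' = {(2 : ZMod (2 ^ n)) ^ (n - 1), 2, (2 : ZMod (2 ^ n)) ^ (n - 1) - 2}) ∨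
        (M = {(2 : ZMod (2 ^ n)) ^ (n - 1), 2, (2 : ZMod (2 ^ n)) ^ (n - 1) - 2} ∧
          M' = {(2 : ZMod (2 ^ n)) ^ (n - 1) - 2, 1, (2 : ZMod (2 ^ n)) ^ (n - 1) + 1})) ∨
      ((M = {2, (2 : ZMod (2 ^ n)) ^ (n - 2) - 1, 3 * (2 : ZMod (2 ^ n)) ^ (n - 2) - 1} ∧
          M' = {-4, 2, 2}) ∨
        (M = {-4, 2, 2} ∧
          M' = {2, (2 : ZMod (2 ^ n)) ^ (n - 2) - 1, 3 * (2 : ZMod (2 ^ n)) ^ (n - 2) - 1})) := by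
  rcases h with h | h | h
  · exact Or.inl (h)
  · exact Or.inr (Or.inl (h))
  · exact Or.inr (Or.inr (Or.inl (h)))

/-- List (3), two odd entries against an all-even triple, inside the seven pairs. [cite: KoblitzRohrlich1978, §5 Proposition (p. 1200)] -/
theorem kernel_of_nonunits {M M' : Multiset (ZMod (2 ^ n))}
    (h : (M = {(2 : ZMod (2 ^ n)) ^ (n - 1) - 2, 1, (2 : ZMod (2 ^ n)) ^ (n - 1) + 1} ∧ M' = {-4, 2, 2}) ∨
      (M = {(2 : ZMod (2 ^ n)) ^ (n - 1) - 2, 1, (2 : ZMod (2 ^ n)) ^ (n - 1) + 1} ∧ M' = {(2 : ZMod (2 ^ n)) ^ (n - 1), 2, (2 : ZMod (2 ^ n)) ^ (n - 1) - 2}) ∨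
      (M = {2, (2 : ZMod (2 ^ n)) ^ (n - 2) - 1, 3 * (2 : ZMod (2 ^ n)) ^ (n - 2) - 1} ∧ M' = {-4, 2, 2})) :
    ((M = {-4, 1, 3} ∧
          M' = {(2 : ZMod (2 ^ n)) ^ (n - 1) - 2, (2 : ZMod (2 ^ n)) ^ (n - 1) - 1, 3}) ∨
        (M = {(2 : ZMod (2 ^ n)) ^ (n - 1) - 2, (2 : ZMod (2 ^ n)) ^ (n - 1) - 1, 3} ∧
          M' = {-4, 1, 3})) ∨
      ((M = {-2, 1, 1} ∧
          M' = {(2 : ZMod (2 ^ n)) ^ (n - 1), 1, (2 : ZMod (2 ^ n)) ^ (n - 1) - 1}) ∨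
        (M = {(2 : ZMod (2 ^ n)) ^ (n - 1), 1, (2 : ZMod (2 ^ n)) ^ (n - 1) - 1} ∧
          M' = {-2, 1, 1})) ∨
      ((M = {-2, 1, 1} ∧
          M' = {2, (2 : ZMod (2 ^ n)) ^ (n - 1) - 1, (2 : ZMod (2 ^ n)) ^ (n - 1) - 1}) ∨
        (M = {2, (2 : ZMod (2 ^ n)) ^ (n - 1) - 1, (2 : ZMod (2 ^ n)) ^ (n - 1) - 1} ∧
          M' = {-2, 1, 1})) ∨
      ((M = {(2 : ZMod (2 ^ n)) ^ (n - 1) - 2, 1, (2 : ZMod (2 ^ n)) ^ (n - 1) + 1} ∧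
          M' = {-4, 2, 2}) ∨
        (M = {-4, 2, 2} ∧
          M' = {(2 : ZMod (2 ^ n)) ^ (n - 1) - 2, 1, (2 : ZMod (2 ^ n)) ^ (n - 1) + 1})) ∨
      ((M = {(2 : ZMod (2 ^ n)) ^ (n - 1) - 2, 1, (2 : ZMod (2 ^ n)) ^ (n - 1) + 1} ∧
          M' = {2, (2 : ZMod (2 ^ n)) ^ (n - 2) - 1, 3 * (2 : ZMod (2 ^ n)) ^ (n - 2) - 1}) ∨
        (M = {2, (2 : ZMod (2 ^ n)) ^ (n - 2) - 1, 3 * (2 : ZMod (2 ^ n)) ^ (n - 2) - 1} ∧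
          M' = {(2 : ZMod (2 ^ n)) ^ (n - 1) - 2, 1, (2 : ZMod (2 ^ n)) ^ (n - 1) + 1})) ∨
      ((M = {(2 : ZMod (2 ^ n)) ^ (n - 1) - 2, 1, (2 : ZMod (2 ^ n)) ^ (n - 1) + 1} ∧
          M' = {(2 : ZMod (2 ^ n)) ^ (n - 1), 2, (2 : ZMod (2 ^ n)) ^ (n - 1) - 2}) ∨
        (M = {(2 : ZMod (2 ^ n)) ^ (n - 1), 2, (2 : ZMod (2 ^ n)) ^ (n - 1) - 2} ∧
          M' = {(2 : ZMod (2 ^ n)) ^ (n - 1) - 2, 1, (2 : ZMod (2 ^ n)) ^ (n - 1) + 1})) ∨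
      ((M = {2, (2 : ZMod (2 ^ n)) ^ (n - 2) - 1, 3 * (2 : ZMod (2 ^ n)) ^ (n - 2) - 1} ∧
          M' = {-4, 2, 2}) ∨
        (M = {-4, 2, 2} ∧
          M' = {2, (2 : ZMod (2 ^ n)) ^ (n - 2) - 1, 3 * (2 : ZMod (2 ^ n)) ^ (n - 2) - 1})) := by
  rcases h with h | h | h
  · exact Or.inr (Or.inr (Or.inr (Or.inl (Or.inl h))))
  · exact Or.inr (Or.inr (Or.inr (Or.inr (Or.inr (Or.inl (Or.inl h))))))
  · exact Or.inr (Or.inr (Or.inr (Or.inr (Or.inr (Or.inr (Or.inl h))))))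

/-- List (3), the pair `((N₁−2,1,N₁+1), (2,N₂−1,3N₂−1))`, inside the seven pairs. [cite: KoblitzRohrlich1978, §5 Proposition (p. 1200)] -/
theorem kernel_of_add_pow_pred {M M' : Multiset (ZMod (2 ^ n))}
    (h : M = {(2 : ZMod (2 ^ n)) ^ (n - 1) - 2, 1, (2 : ZMod (2 ^ n)) ^ (n - 1) + 1} ∧
      M' = {2, (2 : ZMod (2 ^ n)) ^ (n - 2) - 1, 3 * (2 : ZMod (2 ^ n)) ^ (n - 2) - 1}) :
    ((M = {-4, 1, 3} ∧
          M' = {(2 : ZMod (2 ^ n)) ^ (n - 1) - 2, (2 : ZMod (2 ^ n)) ^ (n - 1) - 1, 3}) ∨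
        (M = {(2 : ZMod (2 ^ n)) ^ (n - 1) - 2, (2 : ZMod (2 ^ n)) ^ (n - 1) - 1, 3} ∧
          M' = {-4, 1, 3})) ∨
      ((M = {-2, 1, 1} ∧
          M' = {(2 : ZMod (2 ^ n)) ^ (n - 1), 1, (2 : ZMod (2 ^ n)) ^ (n - 1) - 1}) ∨
        (M = {(2 : ZMod (2 ^ n)) ^ (n - 1), 1, (2 : ZMod (2 ^ n)) ^ (n - 1) - 1} ∧
          M' = {-2, 1, 1})) ∨
      ((M = {-2, 1, 1} ∧
          M' = {2, (2 : ZMod (2 ^ n)) ^ (n - 1) - 1, (2 : ZMod (2 ^ n)) ^ (n - 1) - 1}) ∨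
        (M = {2, (2 : ZMod (2 ^ n)) ^ (n - 1) - 1, (2 : ZMod (2 ^ n)) ^ (n - 1) - 1} ∧
          M' = {-2, 1, 1})) ∨
      ((M = {(2 : ZMod (2 ^ n)) ^ (n - 1) - 2, 1, (2 : ZMod (2 ^ n)) ^ (n - 1) + 1} ∧
          M' = {-4, 2, 2}) ∨
        (M = {-4, 2, 2} ∧
          M' = {(2 : ZMod (2 ^ n)) ^ (n - 1) - 2, 1, (2 : ZMod (2 ^ n)) ^ (n - 1) + 1})) ∨
      ((M = {(2 : ZMod (2 ^ n)) ^ (n - 1) - 2, 1, (2 : ZMod (2 ^ n)) ^ (n - 1) + 1} ∧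
          M' = {2, (2 : ZMod (2 ^ n)) ^ (n - 2) - 1, 3 * (2 : ZMod (2 ^ n)) ^ (n - 2) - 1}) ∨
        (M = {2, (2 : ZMod (2 ^ n)) ^ (n - 2) - 1, 3 * (2 : ZMod (2 ^ n)) ^ (n - 2) - 1} ∧
          M' = {(2 : ZMod (2 ^ n)) ^ (n - 1) - 2, 1, (2 : ZMod (2 ^ n)) ^ (n - 1) + 1})) ∨
      ((M = {(2 : ZMod (2 ^ n)) ^ (n - 1) - 2, 1, (2 : ZMod (2 ^ n)) ^ (n - 1) + 1} ∧
          M' = {(2 : ZMod (2 ^ n)) ^ (n - 1), 2, (2 : ZMod (2 ^ n)) ^ (n - 1) - 2}) ∨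
        (M = {(2 : ZMod (2 ^ n)) ^ (n - 1), 2, (2 : ZMod (2 ^ n)) ^ (n - 1) - 2} ∧
          M' = {(2 : ZMod (2 ^ n)) ^ (n - 1) - 2, 1, (2 : ZMod (2 ^ n)) ^ (n - 1) + 1})) ∨
      ((M = {2, (2 : ZMod (2 ^ n)) ^ (n - 2) - 1, 3 * (2 : ZMod (2 ^ n)) ^ (n - 2) - 1} ∧
          M' = {-4, 2, 2}) ∨
        (M = {-4, 2, 2} ∧
          M' = {2, (2 : ZMod (2 ^ n)) ^ (n - 2) - 1, 3 * (2 : ZMod (2 ^ n)) ^ (n - 2) - 1})) :=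
  Or.inr (Or.inr (Or.inr (Or.inr (Or.inl (Or.inl h)))))

end Kernel

/-! ## §6 Two triples with odd entries: assembling the first split, the mixed configurations and the `a₀`-configurations -/

section OddOddAssembly

variable {n : ℕ}

/-- **The case `t = s + N₁`.**  Let `τ = (r, s, s + N₁)`, `τ′ = (r′, s′, t′)` (`s, s′, t′` odd, sums `0`, `H_{τ′} = H_τ`, `n ≥ 4`).
The first split for `(τ′, τ)` and for `((r′, t′, s′), τ)` leaves: `t′ = s′ + N₁` or `s′ = t′ + N₁` (previous theorem: a permutation
or the pair `((N₁−2,1,N₁+1), (2,N₂−1,3N₂−1))`), a mixed configuration (lists (1)–(2)), or `{s′, t′} = {s, s + N₁}` (a permutation).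
[cite: KoblitzRohrlich1978, §5 Proposition (p. 1200)] -/
theorem of_eq_add_pow_pred (hn : 4 ≤ n) {r s r' s' t' : ZMod (2 ^ n)}
    (hr : r ≠ 0) (hs : IsUnit s) (hrst : r + s + (s + (2 : ZMod (2 ^ n)) ^ (n - 1)) = 0)
    (hr' : r' ≠ 0) (hs' : IsUnit s') (ht' : IsUnit t') (hrst' : r' + s' + t' = 0)
    (heq : fermatCMType (2 ^ n) r' s' t' = fermatCMType (2 ^ n) r s (s + (2 : ZMod (2 ^ n)) ^ (n - 1))) :
    ({r', s', t'} : Multiset (ZMod (2 ^ n))) = {r, s, (s + (2 : ZMod (2 ^ n)) ^ (n - 1))} ∨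
      ∃ w : ZMod (2 ^ n), IsUnit w ∧
        (((({w * r, w * s, w * (s + (2 : ZMod (2 ^ n)) ^ (n - 1))} : Multiset (ZMod (2 ^ n))) = {-4, 1, 3} ∧
            ({w * r', w * s', w * t'} : Multiset (ZMod (2 ^ n))) = {(2 : ZMod (2 ^ n)) ^ (n - 1) - 2, (2 : ZMod (2 ^ n)) ^ (n - 1) - 1, 3}) ∨
          (({w * r, w * s, w * (s + (2 : ZMod (2 ^ n)) ^ (n - 1))} : Multiset (ZMod (2 ^ n))) = {(2 : ZMod (2 ^ n)) ^ (n - 1) - 2, (2 : ZMod (2 ^ n)) ^ (n - 1) - 1, 3} ∧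
            ({w * r', w * s', w * t'} : Multiset (ZMod (2 ^ n))) = {-4, 1, 3})) ∨
        ((({w * r, w * s, w * (s + (2 : ZMod (2 ^ n)) ^ (n - 1))} : Multiset (ZMod (2 ^ n))) = {-2, 1, 1} ∧
            ({w * r', w * s', w * t'} : Multiset (ZMod (2 ^ n))) = {(2 : ZMod (2 ^ n)) ^ (n - 1), 1, (2 : ZMod (2 ^ n)) ^ (n - 1) - 1}) ∨
          (({w * r, w * s, w * (s + (2 : ZMod (2 ^ n)) ^ (n - 1))} : Multiset (ZMod (2 ^ n))) = {(2 : ZMod (2 ^ n)) ^ (n - 1), 1, (2 : ZMod (2 ^ n)) ^ (n - 1) - 1} ∧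
            ({w * r', w * s', w * t'} : Multiset (ZMod (2 ^ n))) = {-2, 1, 1})) ∨
        ((({w * r, w * s, w * (s + (2 : ZMod (2 ^ n)) ^ (n - 1))} : Multiset (ZMod (2 ^ n))) = {-2, 1, 1} ∧
            ({w * r', w * s', w * t'} : Multiset (ZMod (2 ^ n))) = {2, (2 : ZMod (2 ^ n)) ^ (n - 1) - 1, (2 : ZMod (2 ^ n)) ^ (n - 1) - 1}) ∨
          (({w * r, w * s, w * (s + (2 : ZMod (2 ^ n)) ^ (n - 1))} : Multiset (ZMod (2 ^ n))) = {2, (2 : ZMod (2 ^ n)) ^ (n - 1) - 1, (2 : ZMod (2 ^ n)) ^ (n - 1) - 1} ∧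
            ({w * r', w * s', w * t'} : Multiset (ZMod (2 ^ n))) = {-2, 1, 1})) ∨
        ((({w * r, w * s, w * (s + (2 : ZMod (2 ^ n)) ^ (n - 1))} : Multiset (ZMod (2 ^ n))) = {(2 : ZMod (2 ^ n)) ^ (n - 1) - 2, 1, (2 : ZMod (2 ^ n)) ^ (n - 1) + 1} ∧
            ({w * r', w * s', w * t'} : Multiset (ZMod (2 ^ n))) = {-4, 2, 2}) ∨
          (({w * r, w * s, w * (s + (2 : ZMod (2 ^ n)) ^ (n - 1))} : Multiset (ZMod (2 ^ n))) = {-4, 2, 2} ∧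
            ({w * r', w * s', w * t'} : Multiset (ZMod (2 ^ n))) = {(2 : ZMod (2 ^ n)) ^ (n - 1) - 2, 1, (2 : ZMod (2 ^ n)) ^ (n - 1) + 1})) ∨
        ((({w * r, w * s, w * (s + (2 : ZMod (2 ^ n)) ^ (n - 1))} : Multiset (ZMod (2 ^ n))) = {(2 : ZMod (2 ^ n)) ^ (n - 1) - 2, 1, (2 : ZMod (2 ^ n)) ^ (n - 1) + 1} ∧
            ({w * r', w * s', w * t'} : Multiset (ZMod (2 ^ n))) = {2, (2 : ZMod (2 ^ n)) ^ (n - 2) - 1, 3 * (2 : ZMod (2 ^ n)) ^ (n - 2) - 1}) ∨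
          (({w * r, w * s, w * (s + (2 : ZMod (2 ^ n)) ^ (n - 1))} : Multiset (ZMod (2 ^ n))) = {2, (2 : ZMod (2 ^ n)) ^ (n - 2) - 1, 3 * (2 : ZMod (2 ^ n)) ^ (n - 2) - 1} ∧
            ({w * r', w * s', w * t'} : Multiset (ZMod (2 ^ n))) = {(2 : ZMod (2 ^ n)) ^ (n - 1) - 2, 1, (2 : ZMod (2 ^ n)) ^ (n - 1) + 1})) ∨
        ((({w * r, w * s, w * (s + (2 : ZMod (2 ^ n)) ^ (n - 1))} : Multiset (ZMod (2 ^ n))) = {(2 : ZMod (2 ^ n)) ^ (n - 1) - 2, 1, (2 : ZMod (2 ^ n)) ^ (n - 1) + 1} ∧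
            ({w * r', w * s', w * t'} : Multiset (ZMod (2 ^ n))) = {(2 : ZMod (2 ^ n)) ^ (n - 1), 2, (2 : ZMod (2 ^ n)) ^ (n - 1) - 2}) ∨
          (({w * r, w * s, w * (s + (2 : ZMod (2 ^ n)) ^ (n - 1))} : Multiset (ZMod (2 ^ n))) = {(2 : ZMod (2 ^ n)) ^ (n - 1), 2, (2 : ZMod (2 ^ n)) ^ (n - 1) - 2} ∧
            ({w * r', w * s', w * t'} : Multiset (ZMod (2 ^ n))) = {(2 : ZMod (2 ^ n)) ^ (n - 1) - 2, 1, (2 : ZMod (2 ^ n)) ^ (n - 1) + 1})) ∨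
        ((({w * r, w * s, w * (s + (2 : ZMod (2 ^ n)) ^ (n - 1))} : Multiset (ZMod (2 ^ n))) = {2, (2 : ZMod (2 ^ n)) ^ (n - 2) - 1, 3 * (2 : ZMod (2 ^ n)) ^ (n - 2) - 1} ∧
            ({w * r', w * s', w * t'} : Multiset (ZMod (2 ^ n))) = {-4, 2, 2}) ∨
          (({w * r, w * s, w * (s + (2 : ZMod (2 ^ n)) ^ (n - 1))} : Multiset (ZMod (2 ^ n))) = {-4, 2, 2} ∧
            ({w * r', w * s', w * t'} : Multiset (ZMod (2 ^ n))) = {2, (2 : ZMod (2 ^ n)) ^ (n - 2) - 1, 3 * (2 : ZMod (2 ^ n)) ^ (n - 2) - 1}))) := by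
  have hn0 : n ≠ 0 := by omega
  haveI : Fact (1 < 2 ^ n) := ⟨Nat.one_lt_pow hn0 (by norm_num)⟩
  set N₁ : ZMod (2 ^ n) := (2 : ZMod (2 ^ n)) ^ (n - 1) with hN₁
  have e2N₁ : 2 * N₁ = 0 := two_mul_pow_pred hn0
  have hN₁0 : N₁ ≠ 0 := two_pow_ne_zero_of_lt (by omega)
  have h2s : ZMod.castHom (dvd_pow_self 2 hn0) (ZMod 2) s = 1 := (isUnit_iff_castHom_two_eq_one hn0 s).1 hs
  have h2N₁ : ZMod.castHom (dvd_pow_self 2 hn0) (ZMod 2) N₁ = 0 := castHom_two_two_pow hn0 (by omega)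
  have hsN : IsUnit (s + N₁) := isUnit_of_castHom_two_eq_one hn0 (by rw [map_add, h2s, h2N₁, add_zero])
  have hrst₂ : r + (s + N₁) + s = 0 := by linear_combination hrst
  have heq₂ : fermatCMType (2 ^ n) r' s' t' = fermatCMType (2 ^ n) r (s + N₁) s :=
    heq.trans (fermatCMType_eq_of_multiset_eq (triple_swap_right r s (s + N₁)))
  have hrst'' : r' + t' + s' = 0 := by linear_combination hrst'
  have heq' : fermatCMType (2 ^ n) r' t' s' = fermatCMType (2 ^ n) r s (s + N₁) :=
    (fermatCMType_eq_of_multiset_eq (triple_swap_right r' t' s')).trans heq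
  have heq₂' : fermatCMType (2 ^ n) r' t' s' = fermatCMType (2 ^ n) r (s + N₁) s :=
    heq'.trans (fermatCMType_eq_of_multiset_eq (triple_swap_right r s (s + N₁)))
  rcases first_split_of_units hn hr' hs' ht' hrst' hr hs hsN hrst heq.symm with hA | hB | hC | hD
  · -- `t′ = s′ + N₁`
    have ht'v : t' = s' + N₁ := hA.symm
    subst ht'v
    rcases exceptional_of_add_pow_pred hn hr hs hrst hr' hs' hrst' heq with hperm | ⟨w, hw, h₁, h₂⟩
    · exact Or.inl hperm
    · exact Or.inr ⟨w, hw, kernel_of_add_pow_pred ⟨h₁, h₂⟩⟩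
  · -- `s′ = N₁ − s`
    have hs'v : s' = -s + N₁ := by linear_combination -hB - e2N₁
    rcases mixed_of_units hn hr hs hsN hrst hr' ht' hrst' hs'v heq with hperm | ⟨w, hw, h⟩
    · exact Or.inl hperm
    · exact Or.inr ⟨w, hw, kernel_of_mixed h⟩
  · -- `s′ = N₁ − (s + N₁)`: mixed for `(r, s + N₁, s)`
    have hs'v : s' = -(s + N₁) + N₁ := by linear_combination -hC - e2N₁
    rcases mixed_of_units hn hr hsN hs hrst₂ hr' ht' hrst' hs'v heq₂ with hperm | ⟨w, hw, h⟩
    · left; rw [hperm]; exact triple_swap_right _ _ _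
    · right; refine ⟨w, hw, ?_⟩
      rw [triple_swap_right (w * r) (w * (s + N₁)) (w * s)] at h
      exact kernel_of_mixed h
  · rcases first_split_of_units hn hr' ht' hs' hrst'' hr hs hsN hrst heq'.symm with hA₄ | hB₄ | hC₄ | hD₄
    · -- `s′ = t′ + N₁`
      have hs'v : s' = t' + N₁ := hA₄.symm
      subst hs'v
      rcases exceptional_of_add_pow_pred hn hr hs hrst hr' ht' hrst'' heq' with hperm | ⟨w, hw, h₁, h₂⟩
      · left; rw [← hperm]; exact triple_swap_right _ _ _
      · right; refine ⟨w, hw, ?_⟩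
        rw [triple_swap_right (w * r') (w * t') (w * (t' + N₁))] at h₂
        exact kernel_of_add_pow_pred ⟨h₁, h₂⟩
    · -- `t′ = N₁ − s`: mixed for `(r′, t′, s′)`
      have ht'v : t' = -s + N₁ := by linear_combination -hB₄ - e2N₁
      rcases mixed_of_units hn hr hs hsN hrst hr' hs' hrst'' ht'v heq' with hperm | ⟨w, hw, h⟩
      · left; rw [← hperm]; exact triple_swap_right _ _ _
      · right; refine ⟨w, hw, ?_⟩
        rw [triple_swap_right (w * r') (w * t') (w * s')] at h
        exact kernel_of_mixed h
    · -- `t′ = N₁ − (s + N₁)`: mixed for `(r, s + N₁, s)` and `(r′, t′, s′)`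
      have ht'v : t' = -(s + N₁) + N₁ := by linear_combination -hC₄ - e2N₁
      rcases mixed_of_units hn hr hsN hs hrst₂ hr' hs' hrst'' ht'v heq₂' with hperm | ⟨w, hw, h⟩
      · left; rw [triple_swap_right r' s' t', hperm]; exact triple_swap_right _ _ _
      · right; refine ⟨w, hw, ?_⟩
        rw [triple_swap_right (w * r') (w * t') (w * s'), triple_swap_right (w * r) (w * (s + N₁)) (w * s)] at h
        exact kernel_of_mixed h
    · -- `{s′, t′} = {s, s + N₁}`: a permutation
      left
      obtain ⟨hD₁, hD₂⟩ := hD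
      obtain ⟨hD₃, hD₄⟩ := hD₄
      have hne : s' ≠ t' := fun h => by
        obtain ⟨h₁, h₂⟩ := hD₂ h
        exact hN₁0 (by linear_combination h₁ - h₂)
      rcases hD₁ with h₁ | h₁ <;> rcases hD₃ with h₂ | h₂
      · exact absurd (h₁.trans h₂.symm) hne
      · subst h₁; subst h₂
        rw [show r' = r by linear_combination hrst' - hrst]
      · subst h₁; subst h₂
        rw [show r' = r by linear_combination hrst' - hrst]
        exact triple_swap_right _ _ _
      · exact absurd (h₁.trans h₂.symm) hne

/-- **TWO TRIPLES WITH ODD ENTRIES (lists (1)–(2) and the third pair of list (3)).**  Let `N = 2ⁿ`, `n ≥ 4`, `τ = (r, s, t)`,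
`τ′ = (r′, s′, t′)` with `s, t, s′, t′` odd, `r, r′ ≠ 0`, sums `0`, `H_{τ′} = H_τ`.  Then `τ′` is a permutation of `τ`, or for a unit `w`
the pair `(wτ, wτ′)` — or `(wτ′, wτ)` — is, up to permutations within the triples, one of K–R's pairs `((N−4,1,3), (N₁−2,N₁−1,3))`,
`((N−2,1,1), (N₁,1,N₁−1))`, `((N−2,1,1), (2,N₁−1,N₁−1))`, `((N₁−2,1,N₁+1), (2,N₂−1,3N₂−1))` (the first split at `s` and at `t`, then the
two previous theorems). [cite: KoblitzRohrlich1978, §5 Proposition, lists (1)–(3) (p. 1200)] -/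
theorem perm_or_exceptional_of_units (hn : 4 ≤ n) {r s t r' s' t' : ZMod (2 ^ n)}
    (hr : r ≠ 0) (hs : IsUnit s) (ht : IsUnit t) (hrst : r + s + t = 0)
    (hr' : r' ≠ 0) (hs' : IsUnit s') (ht' : IsUnit t') (hrst' : r' + s' + t' = 0)
    (heq : fermatCMType (2 ^ n) r' s' t' = fermatCMType (2 ^ n) r s t) :
    ({r', s', t'} : Multiset (ZMod (2 ^ n))) = {r, s, t} ∨
      ∃ w : ZMod (2 ^ n), IsUnit w ∧
        (((({w * r, w * s, w * t} : Multiset (ZMod (2 ^ n))) = {-4, 1, 3} ∧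
            ({w * r', w * s', w * t'} : Multiset (ZMod (2 ^ n))) = {(2 : ZMod (2 ^ n)) ^ (n - 1) - 2, (2 : ZMod (2 ^ n)) ^ (n - 1) - 1, 3}) ∨
          (({w * r, w * s, w * t} : Multiset (ZMod (2 ^ n))) = {(2 : ZMod (2 ^ n)) ^ (n - 1) - 2, (2 : ZMod (2 ^ n)) ^ (n - 1) - 1, 3} ∧
            ({w * r', w * s', w * t'} : Multiset (ZMod (2 ^ n))) = {-4, 1, 3})) ∨
        ((({w * r, w * s, w * t} : Multiset (ZMod (2 ^ n))) = {-2, 1, 1} ∧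
            ({w * r', w * s', w * t'} : Multiset (ZMod (2 ^ n))) = {(2 : ZMod (2 ^ n)) ^ (n - 1), 1, (2 : ZMod (2 ^ n)) ^ (n - 1) - 1}) ∨
          (({w * r, w * s, w * t} : Multiset (ZMod (2 ^ n))) = {(2 : ZMod (2 ^ n)) ^ (n - 1), 1, (2 : ZMod (2 ^ n)) ^ (n - 1) - 1} ∧
            ({w * r', w * s', w * t'} : Multiset (ZMod (2 ^ n))) = {-2, 1, 1})) ∨
        ((({w * r, w * s, w * t} : Multiset (ZMod (2 ^ n))) = {-2, 1, 1} ∧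
            ({w * r', w * s', w * t'} : Multiset (ZMod (2 ^ n))) = {2, (2 : ZMod (2 ^ n)) ^ (n - 1) - 1, (2 : ZMod (2 ^ n)) ^ (n - 1) - 1}) ∨
          (({w * r, w * s, w * t} : Multiset (ZMod (2 ^ n))) = {2, (2 : ZMod (2 ^ n)) ^ (n - 1) - 1, (2 : ZMod (2 ^ n)) ^ (n - 1) - 1} ∧
            ({w * r', w * s', w * t'} : Multiset (ZMod (2 ^ n))) = {-2, 1, 1})) ∨
        ((({w * r, w * s, w * t} : Multiset (ZMod (2 ^ n))) = {(2 : ZMod (2 ^ n)) ^ (n - 1) - 2, 1, (2 : ZMod (2 ^ n)) ^ (n - 1) + 1} ∧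
            ({w * r', w * s', w * t'} : Multiset (ZMod (2 ^ n))) = {-4, 2, 2}) ∨
          (({w * r, w * s, w * t} : Multiset (ZMod (2 ^ n))) = {-4, 2, 2} ∧
            ({w * r', w * s', w * t'} : Multiset (ZMod (2 ^ n))) = {(2 : ZMod (2 ^ n)) ^ (n - 1) - 2, 1, (2 : ZMod (2 ^ n)) ^ (n - 1) + 1})) ∨
        ((({w * r, w * s, w * t} : Multiset (ZMod (2 ^ n))) = {(2 : ZMod (2 ^ n)) ^ (n - 1) - 2, 1, (2 : ZMod (2 ^ n)) ^ (n - 1) + 1} ∧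
            ({w * r', w * s', w * t'} : Multiset (ZMod (2 ^ n))) = {2, (2 : ZMod (2 ^ n)) ^ (n - 2) - 1, 3 * (2 : ZMod (2 ^ n)) ^ (n - 2) - 1}) ∨
          (({w * r, w * s, w * t} : Multiset (ZMod (2 ^ n))) = {2, (2 : ZMod (2 ^ n)) ^ (n - 2) - 1, 3 * (2 : ZMod (2 ^ n)) ^ (n - 2) - 1} ∧
            ({w * r', w * s', w * t'} : Multiset (ZMod (2 ^ n))) = {(2 : ZMod (2 ^ n)) ^ (n - 1) - 2, 1, (2 : ZMod (2 ^ n)) ^ (n - 1) + 1})) ∨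
        ((({w * r, w * s, w * t} : Multiset (ZMod (2 ^ n))) = {(2 : ZMod (2 ^ n)) ^ (n - 1) - 2, 1, (2 : ZMod (2 ^ n)) ^ (n - 1) + 1} ∧
            ({w * r', w * s', w * t'} : Multiset (ZMod (2 ^ n))) = {(2 : ZMod (2 ^ n)) ^ (n - 1), 2, (2 : ZMod (2 ^ n)) ^ (n - 1) - 2}) ∨
          (({w * r, w * s, w * t} : Multiset (ZMod (2 ^ n))) = {(2 : ZMod (2 ^ n)) ^ (n - 1), 2, (2 : ZMod (2 ^ n)) ^ (n - 1) - 2} ∧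
            ({w * r', w * s', w * t'} : Multiset (ZMod (2 ^ n))) = {(2 : ZMod (2 ^ n)) ^ (n - 1) - 2, 1, (2 : ZMod (2 ^ n)) ^ (n - 1) + 1})) ∨
        ((({w * r, w * s, w * t} : Multiset (ZMod (2 ^ n))) = {2, (2 : ZMod (2 ^ n)) ^ (n - 2) - 1, 3 * (2 : ZMod (2 ^ n)) ^ (n - 2) - 1} ∧
            ({w * r', w * s', w * t'} : Multiset (ZMod (2 ^ n))) = {-4, 2, 2}) ∨
          (({w * r, w * s, w * t} : Multiset (ZMod (2 ^ n))) = {-4, 2, 2} ∧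
            ({w * r', w * s', w * t'} : Multiset (ZMod (2 ^ n))) = {2, (2 : ZMod (2 ^ n)) ^ (n - 2) - 1, 3 * (2 : ZMod (2 ^ n)) ^ (n - 2) - 1}))) := by
  have hn0 : n ≠ 0 := by omega
  set N₁ : ZMod (2 ^ n) := (2 : ZMod (2 ^ n)) ^ (n - 1) with hN₁
  have e2N₁ : 2 * N₁ = 0 := two_mul_pow_pred hn0
  have hrst₂ : r + t + s = 0 := by linear_combination hrst
  have hrst'' : r' + t' + s' = 0 := by linear_combination hrst'
  have heq₂ : fermatCMType (2 ^ n) r' s' t' = fermatCMType (2 ^ n) r t s :=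
    heq.trans (fermatCMType_eq_of_multiset_eq (triple_swap_right r s t))
  have heq' : fermatCMType (2 ^ n) r' t' s' = fermatCMType (2 ^ n) r s t :=
    (fermatCMType_eq_of_multiset_eq (triple_swap_right r' t' s')).trans heq
  have heq₃ : fermatCMType (2 ^ n) r' t' s' = fermatCMType (2 ^ n) r t s :=
    heq'.trans (fermatCMType_eq_of_multiset_eq (triple_swap_right r s t))
  rcases first_split_of_units hn hr hs ht hrst hr' hs' ht' hrst' heq with hA | hB | hC | hD
  · -- `t = s + N₁`
    have htv : t = s + N₁ := hA.symm
    subst htv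
    exact of_eq_add_pow_pred hn hr hs hrst hr' hs' ht' hrst' heq
  · -- `s′ = N₁ − s`
    have hs'v : s' = -s + N₁ := by linear_combination -hB - e2N₁
    rcases mixed_of_units hn hr hs ht hrst hr' ht' hrst' hs'v heq with hperm | ⟨w, hw, h⟩
    · exact Or.inl hperm
    · exact Or.inr ⟨w, hw, kernel_of_mixed h⟩
  · -- `t′ = N₁ − s`: mixed for `(r′, t′, s′)`
    have ht'v : t' = -s + N₁ := by linear_combination -hC - e2N₁
    rcases mixed_of_units hn hr hs ht hrst hr' hs' hrst'' ht'v heq' with hperm | ⟨w, hw, h⟩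
    · left; rw [← hperm]; exact triple_swap_right _ _ _
    · right; refine ⟨w, hw, ?_⟩
      rw [triple_swap_right (w * r') (w * t') (w * s')] at h
      exact kernel_of_mixed h
  · rcases first_split_of_units hn hr ht hs hrst₂ hr' hs' ht' hrst' heq₂ with hA₂ | hB₂ | hC₂ | hD₂
    · -- `s = t + N₁`
      have hsv : s = t + N₁ := hA₂.symm
      subst hsv
      have hrst₃ : r + t + (t + N₁) = 0 := by linear_combination hrst
      rcases of_eq_add_pow_pred hn hr ht hrst₃ hr' hs' ht' hrst' heq₂ with hperm | ⟨w, hw, h⟩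
      · left; rw [hperm]; exact triple_swap_right _ _ _
      · right; refine ⟨w, hw, ?_⟩
        rw [triple_swap_right (w * r) (w * t) (w * (t + N₁))] at h
        exact h
    · -- `s′ = N₁ − t`: mixed for `(r, t, s)`
      have hs'v : s' = -t + N₁ := by linear_combination -hB₂ - e2N₁
      rcases mixed_of_units hn hr ht hs hrst₂ hr' ht' hrst' hs'v heq₂ with hperm | ⟨w, hw, h⟩
      · left; rw [hperm]; exact triple_swap_right _ _ _
      · right; refine ⟨w, hw, ?_⟩
        rw [triple_swap_right (w * r) (w * t) (w * s)] at h
        exact kernel_of_mixed h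
    · -- `t′ = N₁ − t`: mixed for `(r, t, s)` and `(r′, t′, s′)`
      have ht'v : t' = -t + N₁ := by linear_combination -hC₂ - e2N₁
      rcases mixed_of_units hn hr ht hs hrst₂ hr' hs' hrst'' ht'v heq₃ with hperm | ⟨w, hw, h⟩
      · left; rw [triple_swap_right r' s' t', hperm]; exact triple_swap_right _ _ _
      · right; refine ⟨w, hw, ?_⟩
        rw [triple_swap_right (w * r') (w * t') (w * s'), triple_swap_right (w * r) (w * t) (w * s)] at h
        exact kernel_of_mixed h
    · -- `{s, t} ⊆ {s′, t′}`: a permutation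
      left
      obtain ⟨hD₁, hD₁'⟩ := hD
      obtain ⟨hD₃, hD₃'⟩ := hD₂
      by_cases hst : s = t
      · obtain ⟨h₁, h₂⟩ := hD₁' hst
        subst hst; subst h₁; subst h₂
        rw [show r' = r by linear_combination hrst' - hrst]
      · rcases hD₁ with h₁ | h₁ <;> rcases hD₃ with h₂ | h₂
        · exact absurd (h₁.trans h₂.symm) hst
        · subst h₁; subst h₂
          rw [show r' = r by linear_combination hrst' - hrst]
        · subst h₁; subst h₂
          rw [show r' = r by linear_combination hrst' - hrst]
          exact triple_swap_right _ _ _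
        · exact absurd (h₁.trans h₂.symm) hst

end OddOddAssembly

/-! ## §7 KOBLITZ–ROHRLICH'S §5 PROPOSITION (THEOREM 4's "the only isogenies") FOR EVERY `n ≥ 4` -/

section Main

variable {n : ℕ}

/-- **KOBLITZ–ROHRLICH, §5 PROPOSITION (THEOREM 4, `N = 2ⁿ`: "the only isogenies apart from the obvious ones") FOR EVERY `n ≥ 4`.**
"PROPOSITION. Let `N = 2ⁿ`, `n ≥ 4`. Let `N₁ = 2ⁿ⁻¹`, `N₂ = 2ⁿ⁻²`, `τ = (r, s, t)`, `τ′ = (r′, s′, t′)`, `H_τ = H_{τ′}`. Suppose that `τ′` is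
not a permutation of `τ`, and that g.c.d.`(r, s, t, r′, s′, t′) = 1`. Then for some `u ∈ (ℤ/Nℤ)*`, `uτ` and `uτ′` are permutations of one
of the following pairs of triples: (1) `(N − 4, 1, 3)`, `(N₁ − 2, N₁ − 1, 3)`; (2) any 2 of the triples `(N − 2, 1, 1)`, `(N₁, 1, N₁ − 1)`,
`(2, N₁ − 1, N₁ − 1)`; (3) any 2 of the triples `(N − 4, 2, 2)`, `(N₁, 2, N₁ − 2)`, `(N₁ − 2, 1, N₁ + 1)`, `(2, N₂ − 1, 3N₂ − 1)`."
Tree form: for triples of non-zero residues modulo `2ⁿ` (`n ≥ 4`) with `r + s + t = 0 = r′ + s′ + t′`, a unit among the six entries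
(g.c.d. `= 1`) and `H_{τ′} = H_τ`: EITHER `{r′, s′, t′} = {r, s, t}` OR there is a unit `w` such that `({wr, ws, wt}, {wr′, ws′, wt′})` or
`({wr′, ws′, wt′}, {wr, ws, wt})` is one of the SEVEN pairs `((N−4,1,3), (N₁−2,N₁−1,3))`, `((N−2,1,1), (N₁,1,N₁−1))`,
`((N−2,1,1), (2,N₁−1,N₁−1))`, `((N₁−2,1,N₁+1), (N−4,2,2))`, `((N₁−2,1,N₁+1), (2,N₂−1,3N₂−1))`, `((N₁−2,1,N₁+1), (N₁,2,N₁−2))`,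
`((2,N₂−1,3N₂−1), (N−4,2,2))` — every one of them printed in (1)–(3); of K–R's ten printed pairs the remaining three are
`((N₁,1,N₁−1), (2,N₁−1,N₁−1))` and `((N₁,2,N₁−2), (2,N₂−1,3N₂−1))` (the pairs `((N₁,1,N₁−1), (N−2,1,1))`, `((N₁,2,N₁−2), (N₁−2,1,N₁+1))`
multiplied through by the units `N₁ − 1`, `N₂ − 1`) and `((N−4,2,2), (N₁,2,N₁−2))` (no odd entry: g.c.d. `= 2`).  K–R: "Most of the
proof is similar to the proof of Theorem 2, and will be omitted … our proof of the 'relatively prime case' when `N = 2ⁿ` needs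
another technique, based on a probabilistic consideration" (the Probabilistic Lemma, `n ≥ 9`; `N = 16, …, 256` "verified by
computer"); HERE every case is read off the parity criterion at `p = 2` (§§3–6).  The siblings had complete lists at `N = 8` and,
normalised, `16` by kernel enumeration (`CyclotomicFermatCMTypesTwoPowerLevelIsogenies`, `…TwoPowerLevelSixteen`) and the existence
half for every `n` (`…TwoPowerLevelCoincidences`, `…TwoPowerLevelFurthermore`, `…TwoPowerLevelFamilies`).
[cite: KoblitzRohrlich1978, §5 Proposition (p. 1200); Theorem 4 (p. 1186)] -/
theorem perm_or_exceptional_of_fermatCMType_eq_twoPow (hn : 4 ≤ n) {r s t r' s' t' : ZMod (2 ^ n)}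
    (hr0 : r ≠ 0) (hs0 : s ≠ 0) (ht0 : t ≠ 0) (hrst : r + s + t = 0)
    (hr'0 : r' ≠ 0) (hs'0 : s' ≠ 0) (ht'0 : t' ≠ 0) (hrst' : r' + s' + t' = 0)
    (hunit : IsUnit r ∨ IsUnit s ∨ IsUnit t ∨ IsUnit r' ∨ IsUnit s' ∨ IsUnit t')
    (heq : fermatCMType (2 ^ n) r' s' t' = fermatCMType (2 ^ n) r s t) :
    ({r', s', t'} : Multiset (ZMod (2 ^ n))) = {r, s, t} ∨
      ∃ w : ZMod (2 ^ n), IsUnit w ∧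
        (((({w * r, w * s, w * t} : Multiset (ZMod (2 ^ n))) = {-4, 1, 3} ∧
            ({w * r', w * s', w * t'} : Multiset (ZMod (2 ^ n))) = {(2 : ZMod (2 ^ n)) ^ (n - 1) - 2, (2 : ZMod (2 ^ n)) ^ (n - 1) - 1, 3}) ∨
          (({w * r, w * s, w * t} : Multiset (ZMod (2 ^ n))) = {(2 : ZMod (2 ^ n)) ^ (n - 1) - 2, (2 : ZMod (2 ^ n)) ^ (n - 1) - 1, 3} ∧
            ({w * r', w * s', w * t'} : Multiset (ZMod (2 ^ n))) = {-4, 1, 3})) ∨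
        ((({w * r, w * s, w * t} : Multiset (ZMod (2 ^ n))) = {-2, 1, 1} ∧
            ({w * r', w * s', w * t'} : Multiset (ZMod (2 ^ n))) = {(2 : ZMod (2 ^ n)) ^ (n - 1), 1, (2 : ZMod (2 ^ n)) ^ (n - 1) - 1}) ∨
          (({w * r, w * s, w * t} : Multiset (ZMod (2 ^ n))) = {(2 : ZMod (2 ^ n)) ^ (n - 1), 1, (2 : ZMod (2 ^ n)) ^ (n - 1) - 1} ∧
            ({w * r', w * s', w * t'} : Multiset (ZMod (2 ^ n))) = {-2, 1, 1})) ∨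
        ((({w * r, w * s, w * t} : Multiset (ZMod (2 ^ n))) = {-2, 1, 1} ∧
            ({w * r', w * s', w * t'} : Multiset (ZMod (2 ^ n))) = {2, (2 : ZMod (2 ^ n)) ^ (n - 1) - 1, (2 : ZMod (2 ^ n)) ^ (n - 1) - 1}) ∨
          (({w * r, w * s, w * t} : Multiset (ZMod (2 ^ n))) = {2, (2 : ZMod (2 ^ n)) ^ (n - 1) - 1, (2 : ZMod (2 ^ n)) ^ (n - 1) - 1} ∧
            ({w * r', w * s', w * t'} : Multiset (ZMod (2 ^ n))) = {-2, 1, 1})) ∨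
        ((({w * r, w * s, w * t} : Multiset (ZMod (2 ^ n))) = {(2 : ZMod (2 ^ n)) ^ (n - 1) - 2, 1, (2 : ZMod (2 ^ n)) ^ (n - 1) + 1} ∧
            ({w * r', w * s', w * t'} : Multiset (ZMod (2 ^ n))) = {-4, 2, 2}) ∨
          (({w * r, w * s, w * t} : Multiset (ZMod (2 ^ n))) = {-4, 2, 2} ∧
            ({w * r', w * s', w * t'} : Multiset (ZMod (2 ^ n))) = {(2 : ZMod (2 ^ n)) ^ (n - 1) - 2, 1, (2 : ZMod (2 ^ n)) ^ (n - 1) + 1})) ∨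
        ((({w * r, w * s, w * t} : Multiset (ZMod (2 ^ n))) = {(2 : ZMod (2 ^ n)) ^ (n - 1) - 2, 1, (2 : ZMod (2 ^ n)) ^ (n - 1) + 1} ∧
            ({w * r', w * s', w * t'} : Multiset (ZMod (2 ^ n))) = {2, (2 : ZMod (2 ^ n)) ^ (n - 2) - 1, 3 * (2 : ZMod (2 ^ n)) ^ (n - 2) - 1}) ∨
          (({w * r, w * s, w * t} : Multiset (ZMod (2 ^ n))) = {2, (2 : ZMod (2 ^ n)) ^ (n - 2) - 1, 3 * (2 : ZMod (2 ^ n)) ^ (n - 2) - 1} ∧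
            ({w * r', w * s', w * t'} : Multiset (ZMod (2 ^ n))) = {(2 : ZMod (2 ^ n)) ^ (n - 1) - 2, 1, (2 : ZMod (2 ^ n)) ^ (n - 1) + 1})) ∨
        ((({w * r, w * s, w * t} : Multiset (ZMod (2 ^ n))) = {(2 : ZMod (2 ^ n)) ^ (n - 1) - 2, 1, (2 : ZMod (2 ^ n)) ^ (n - 1) + 1} ∧
            ({w * r', w * s', w * t'} : Multiset (ZMod (2 ^ n))) = {(2 : ZMod (2 ^ n)) ^ (n - 1), 2, (2 : ZMod (2 ^ n)) ^ (n - 1) - 2}) ∨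
          (({w * r, w * s, w * t} : Multiset (ZMod (2 ^ n))) = {(2 : ZMod (2 ^ n)) ^ (n - 1), 2, (2 : ZMod (2 ^ n)) ^ (n - 1) - 2} ∧
            ({w * r', w * s', w * t'} : Multiset (ZMod (2 ^ n))) = {(2 : ZMod (2 ^ n)) ^ (n - 1) - 2, 1, (2 : ZMod (2 ^ n)) ^ (n - 1) + 1})) ∨
        ((({w * r, w * s, w * t} : Multiset (ZMod (2 ^ n))) = {2, (2 : ZMod (2 ^ n)) ^ (n - 2) - 1, 3 * (2 : ZMod (2 ^ n)) ^ (n - 2) - 1} ∧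
            ({w * r', w * s', w * t'} : Multiset (ZMod (2 ^ n))) = {-4, 2, 2}) ∨
          (({w * r, w * s, w * t} : Multiset (ZMod (2 ^ n))) = {-4, 2, 2} ∧
            ({w * r', w * s', w * t'} : Multiset (ZMod (2 ^ n))) = {2, (2 : ZMod (2 ^ n)) ^ (n - 2) - 1, 3 * (2 : ZMod (2 ^ n)) ^ (n - 2) - 1}))) := by
  have hn0 : n ≠ 0 := by omega
  rcases pattern_of_triple_two hn0 hr0 hs0 ht0 hrst with ⟨hr, hs, ht⟩ | ⟨a, b, c, habc, ha0, hau, hb, hc, hsum⟩ <;>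
    rcases pattern_of_triple_two hn0 hr'0 hs'0 ht'0 hrst' with ⟨hr', hs', ht'⟩ | ⟨a', b', c', habc', ha'0, ha'u, hb', hc', hsum'⟩
  · -- all six entries even: excluded by the g.c.d. hypothesis
    exfalso
    rcases hunit with h | h | h | h | h | h
    exacts [hr h, hs h, ht h, hr' h, hs' h, ht' h]
  · -- `τ` even, `τ′` with two odd entries: list (3), exchanged
    have heq₁ : fermatCMType (2 ^ n) r s t = fermatCMType (2 ^ n) a' b' c' :=
      heq.symm.trans (fermatCMType_eq_of_multiset_eq habc').symm
    obtain ⟨w, hw, h⟩ := exceptional_of_nonunits hn ha'0 hb' hc' hsum' hr0 hs0 ht0 hr hs ht hrst heq₁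
    refine Or.inr ⟨w, hw, kernel_symm (kernel_of_nonunits ?_)⟩
    rw [mul_triple_eq_of_triple_eq w habc'] at h
    exact h
  · -- `τ` with two odd entries, `τ′` even: list (3)
    have heq₂ : fermatCMType (2 ^ n) r' s' t' = fermatCMType (2 ^ n) a b c :=
      heq.trans (fermatCMType_eq_of_multiset_eq habc).symm
    obtain ⟨w, hw, h⟩ := exceptional_of_nonunits hn ha0 hb hc hsum hr'0 hs'0 ht'0 hr' hs' ht' hrst' heq₂
    refine Or.inr ⟨w, hw, kernel_of_nonunits ?_⟩
    rw [mul_triple_eq_of_triple_eq w habc] at h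
    exact h
  · -- both with two odd entries: lists (1)–(3)
    have heq₃ : fermatCMType (2 ^ n) a' b' c' = fermatCMType (2 ^ n) a b c :=
      (fermatCMType_eq_of_multiset_eq habc').trans (heq.trans (fermatCMType_eq_of_multiset_eq habc).symm)
    rcases perm_or_exceptional_of_units hn ha0 hb hc hsum ha'0 hb' hc' hsum' heq₃ with hperm | ⟨w, hw, h⟩
    · left; rw [← habc, ← habc', hperm]
    · right; refine ⟨w, hw, ?_⟩
      rw [mul_triple_eq_of_triple_eq w habc, mul_triple_eq_of_triple_eq w habc'] at h
      exact h

/-- **The seven pairs at `N = 16`** (`N₁ = 8`, `N₂ = 4`): `(12,1,3) ~ (6,7,3)`; `(14,1,1) ~ (8,1,7)`, `(2,7,7)`; `(6,1,9) ~ (12,2,2)`,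
`(2,3,11)`, `(8,2,6)`; `(2,3,11) ~ (12,2,2)` — the pairs of the sibling `CyclotomicFermatCMTypesTwoPowerLevelIsogenies`
(`fermatCMType_sixteen_a₀`, `_c`, `_d₀`, `_e`, `_a₀_e₁`). [cite: KoblitzRohrlich1978, Theorem 4 (p. 1186) and §5 Proposition (p. 1200)] -/
theorem exceptional_pairs_values_sixteen :
    ((-4 : ZMod 16), (1 : ZMod 16), (3 : ZMod 16)) = (12, 1, 3) ∧
      ((2 : ZMod 16) ^ (4 - 1) - 2, (2 : ZMod 16) ^ (4 - 1) - 1, (3 : ZMod 16)) = (6, 7, 3) ∧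
    ((-2 : ZMod 16), (1 : ZMod 16), (1 : ZMod 16)) = (14, 1, 1) ∧
      ((2 : ZMod 16) ^ (4 - 1), (1 : ZMod 16), (2 : ZMod 16) ^ (4 - 1) - 1) = (8, 1, 7) ∧
      ((2 : ZMod 16), (2 : ZMod 16) ^ (4 - 1) - 1, (2 : ZMod 16) ^ (4 - 1) - 1) = (2, 7, 7) ∧
    ((2 : ZMod 16) ^ (4 - 1) - 2, (1 : ZMod 16), (2 : ZMod 16) ^ (4 - 1) + 1) = (6, 1, 9) ∧
      ((-4 : ZMod 16), (2 : ZMod 16), (2 : ZMod 16)) = (12, 2, 2) ∧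
      ((2 : ZMod 16) ^ (4 - 1), (2 : ZMod 16), (2 : ZMod 16) ^ (4 - 1) - 2) = (8, 2, 6) ∧
      ((2 : ZMod 16), (2 : ZMod 16) ^ (4 - 2) - 1, 3 * (2 : ZMod 16) ^ (4 - 2) - 1) = (2, 3, 11) := by
  refine ⟨?_, ?_, ?_, ?_, ?_, ?_, ?_, ?_, ?_⟩ <;> decide

end Main

end CyclotomicFermatCMType

end Literature.AlgebraicGeometry.ComplexMultiplication
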